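import Literature.Computability.QuantumComplexity.PermanentReductionCodes
import Literature.Computability.AlgebraicComplexity.PermanentCodeTranscoder
import Literature.Computability.Complexity.SharpSATMembership
import Literature.Computability.Complexity.FoldBricks
import Literature.Computability.Complexity.PlumbingBricks
import Literature.Computability.Complexity.HashBricks
import Literature.Computability.Complexity.KSATReductions
import HarnessLib

/-!
# Valiant's reduction `#3SAT → PERMANENT(0/1)` as a polynomial-time string function

The machine of Valiant's theorem (TCS 8 (1979), Thm. 1; Lemma 3.1: "there is a function `f ∈ FP`
…"). `PermanentReductionCodes.lean` gives, for a 3CNF `ψ` with `m` clauses, the row-major word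
`bWord ψ` of an explicit `0/1` matrix with `#SAT(ψ) = (PER(bWord ψ) mod (2^{9m}+1)) / 2^{6m}`, every
letter a closed-form function `bEntry ψ a b` of natural-number indices. This file proves that
`w ↦ bWord (decCNF w)` (on codes of 3CNFs; the non-square word `00` otherwise) is in the tree's `FP`
(`Classes.FP`, Mathlib's `TM2ComputableInPolyTime`):

* **`PerRedFP.preF`**, `preF_mem_FP : preF ∈ FP`,
  `preF_apply : preF w = if IsWidthEq 3 (decCNF w) then bWord (decCNF w) else 00`.

No machine is programmed: as everywhere in the tree the map is an assembly of the `FP` bricks of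
`Complexity/` — records and projections (`BrickAlgebra`), branching on one-bit tests (`iteFn`),
counted folds (`FoldBricks.foldLoop`, here the concatenation folds of `PermanentCodeTranscoder.setupS`
and a FIRST-HIT fold `firstOp`/`hitPiece`/`firstHit` for the scans), unary arithmetic
(`Plumb.divModFn`, `polyFn`, `dropFn`), list access (`HashBricks.nthItemFn`). All indices are
unary. The bricks mirror the if-trees of the closed forms one-to-one, each with its `∈ FP` fact and
its value on well-formed records (entries in `{-1,0,1}` travel as the unary codes `zcode`:
`1 ↦ 1`, `-1 ↦ 11`, `0 ↦ ε`):

* formula access `litCF`/`polCF`/`varOF` (`⌜ψ⌝ = encodingCNF.encode ψ`, clause `c`, literal `l`,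
  occurrence `o = 3c + l`); `w3cF` = `ThreeCNFPer.w3c`, `hConstF` = `hConst`, `e3cF`/`coreCF` the
  two `4 × 4` tables, `baseEntryF` = `PerRed.baseEntry`;
* the cyclic next occurrence `nextPosF` = `ThreeCNFPer.nextPos` (two first-hit scans,
  `run_encode`, `firstHit_spec`), the sites `sPosF`, `site1F`, `site2F`, the ports `portEntryF`,
  the two-site matrix `gEntryF` = `PerRed.gEntry`, the slot activities `actUF` = `PerRed.actOf`;
* the `0/1` entries `bEntryF` = `PerRed.bEntry` on the record `wrec` the word folds present, the
  row fold `rowF`, the word fold `wordF` over the padded context `ctxOf ψ = ⟨⌜ψ⌝, 1ⁿ⟩`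
  (`wordF_apply`, `ccat_ccat_eq_bWord`), the width test `w3T` (`SharpSATVerif.width3Fn`) and the
  canonicaliser `KSATRed.canonCNFFn = encode ∘ decCNF` in front.

The post-processing and the assembly of `permanent01_isSharpPHardFun_holds` are in
`PermanentHardnessProofs.lean`.

## References

* L. G. Valiant, *The complexity of computing the permanent*, Theoret. Comput. Sci. 8 (1979)
  189–201, Thm. 1, Lemma 3.1.
* S. Arora, B. Barak, *Computational Complexity: A Modern Approach*, CUP 2009, §1.3 (closure of
  polynomial time under composition and bounded loops), §0.1 (codes of lists).
-/

noncomputable section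
noncomputable section

namespace Literature.Computability.QuantumComplexity

open _root_.Computability Literature.Computability.Complexity Literature.Computability.AlgebraicComplexity
  Literature.Computability.AlgebraicComplexity.ThreeCNFPer Brick HashBricks Plumb OracleCompose Polynomial
open Literature.Computability.Complexity.SharpSATVerif (encode_literal encode_clause encode_cnf)

namespace PerRedFP

variable (ψ : CNF ℕ)

/-! ### Generalities: codes of `{-1,0,1}`, unary comparisons, branching on a decided bit -/

/-- The unary code of an entry in `{-1, 0, 1}`: `1 ↦ 1`, `-1 ↦ 11`, everything else `↦ ε`. [folklore] -/
def zcode (z : ℤ) : List Bool := if z = 1 then [true] else if z = -1 then [true, true] else []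

/-- `zcode 1 = [1]`. [folklore] -/
@[simp] theorem zcode_one : zcode 1 = [true] := rfl
/-- `zcode (-1) = [1,1]`. [folklore] -/
@[simp] theorem zcode_neg_one : zcode (-1) = [true, true] := rfl
/-- `zcode 0 = ε`. [folklore] -/
@[simp] theorem zcode_zero : zcode 0 = [] := rfl

/-- Branching on a decided bit. [folklore] -/
theorem iteFn_decide {c f g : List Bool → List Bool} {z : List Bool} {P : Prop} [Decidable P]
    (h : c z = [decide P]) : iteFn c f g z = if P then f z else g z := by
  rw [iteFn_apply h]
  by_cases hP : P <;> simp [hP]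

/-- `encList = body`. [folklore] -/
theorem encList_eq_body : ∀ l : List (List Bool), encList l = body l
  | [] => rfl
  | a :: l => by rw [encList_cons, body_cons, encList_eq_body l]

/-- The canonical code of a CNF: `⟨1ᵐ, body (clause codes)⟩`. [cite: AroraBarak2009, §0.1] -/
theorem encode_eq : encodingCNF.encode ψ = boolPair (ones ψ.length) (body (ψ.map encodingClause.encode)) := by
  rw [encode_cnf, OracleCompose.unaryEncodeNat_eq_replicate, encList_eq_body]

/-- The code of a clause: `⟨1^{|c|}, body (literal codes)⟩`. [cite: AroraBarak2009, §0.1] -/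
theorem encode_clause_eq (c : Clause ℕ) :
    encodingClause.encode c = boolPair (ones c.length) (body (c.map encodingLiteral.encode)) := by
  rw [encode_clause, OracleCompose.unaryEncodeNat_eq_replicate, encList_eq_body]

/-- Two unary numerals are equal iff their lengths are. [folklore] -/
theorem ones_inj {a b : ℕ} : ones a = ones b ↔ a = b :=
  ⟨fun h => by simpa using congrArg List.length h, fun h => by rw [h]⟩

/-- **`uEqF ⟨1ᵃ, 1ᵇ⟩ = [a = b]`** (string equality). [folklore] -/
def uEqF : List Bool → List Bool := eqPairFn

/-- Value of `uEqF`. [folklore] -/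
@[simp] theorem uEqF_ones (a b : ℕ) : uEqF (boolPair (ones a) (ones b)) = [decide (a = b)] := by
  rw [uEqF, eqPairFn_boolPair, Bool.decide_congr ones_inj]

/-- `uEqF ∈ FP`, one-bit. [folklore] -/
theorem uEqF_mem_FP : uEqF ∈ FP := eqPairFn_mem_FP

/-- `uEqF` is one-bit. [folklore] -/
theorem oneBit_uEqF : OneBit uEqF := oneBit_eqPairFn

/-- **`uLtF ⟨1ᵃ, 1ᵇ⟩ = [a < b]`.** [folklore] -/
def uLtF : List Bool → List Bool := ltLenF

/-- Value of `uLtF`. [folklore] -/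
@[simp] theorem uLtF_ones (a b : ℕ) : uLtF (boolPair (ones a) (ones b)) = [decide (a < b)] := by
  rw [uLtF, ltLenF_boolPair]; simp

/-- `uLtF ∈ FP`. [folklore] -/
theorem uLtF_mem_FP : uLtF ∈ FP := ltLenF_mem_FP

/-- `uLtF` is one-bit. [folklore] -/
theorem oneBit_uLtF : OneBit uLtF := oneBit_ltLenF

/-- **`uLeF ⟨1ᵃ, 1ᵇ⟩ = [a ≤ b]`** (`¬ (b < a)`). [folklore] -/
def uLeF : List Bool → List Bool := notFn (ltLenF ∘ fanoutFn sndF fstF)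

/-- Value of `uLeF`. [folklore] -/
@[simp] theorem uLeF_ones (a b : ℕ) : uLeF (boolPair (ones a) (ones b)) = [decide (a ≤ b)] := by
  rw [uLeF, notFn_apply (b := decide (b < a)) (by simp)]
  congr 1
  rw [Bool.eq_iff_iff]
  simp

/-- `uLeF ∈ FP`. [folklore] -/
theorem uLeF_mem_FP : uLeF ∈ FP := notFn_mem_FP (comp_mem_FP ltLenF_mem_FP (fanoutFn_mem_FP sndF_mem_FP fstF_mem_FP))

/-- `uLeF` is one-bit. [folklore] -/
theorem oneBit_uLeF : OneBit uLeF := oneBit_notFn (oneBit_ltLenF.comp _)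

/-- **`uSubF ⟨1ᵃ, 1ᵇ⟩ = 1^{b - a}`** (drop). [folklore] -/
def uSubF : List Bool → List Bool := dropFn

/-- Value of `uSubF`. [folklore] -/
@[simp] theorem uSubF_ones (a b : ℕ) : uSubF (boolPair (ones a) (ones b)) = ones (b - a) := by
  rw [uSubF, dropFn_boolPair, List.length_replicate, List.drop_replicate]

/-- `uSubF ∈ FP`. [folklore] -/
theorem uSubF_mem_FP : uSubF ∈ FP := dropFn_mem_FP

/-- Appending unary numerals adds. [folklore] -/
theorem ones_append (a b : ℕ) : ones a ++ ones b = ones (a + b) :=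
  (List.replicate_add a b true).symm

/-- `1 :: 1ᵃ = 1^{a+1}`. [folklore] -/
theorem true_cons_ones (a : ℕ) : true :: ones a = ones (a + 1) := rfl

/-- `divModFn` with a constant divisor `d`: `1ᵃ ↦ ⟨1^{a/d}, 1^{a mod d}⟩`. [folklore] -/
def qrF (d : ℕ) : List Bool → List Bool := divModFn ∘ fanoutFn (fun _ => ones d) id

/-- Value of `qrF`. [folklore] -/
@[simp] theorem qrF_ones (d a : ℕ) : qrF d (ones a) = boolPair (ones (a / d)) (ones (a % d)) := by
  simp [qrF]

/-- `qrF d ∈ FP`. [folklore] -/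
theorem qrF_mem_FP (d : ℕ) : qrF d ∈ FP := comp_mem_FP divModFn_mem_FP (fanoutFn_mem_FP (const_mem_FP _) id_mem_FP)

/-! ### Reading the formula: the polarity of a literal -/

/-- **The code of the literal `l` of clause `c`**, on `⟨⌜ψ⌝, ⟨1ᶜ, 1ˡ⟩⟩`: item `l` of item `c` of the
clause list (two `nthItemFn` look-ups). [cite: AroraBarak2009, §1.3 (loops)] -/
def litCF : List Bool → List Bool :=
  nthItemFn ∘ fanoutFn (sndPow 1) (sndF ∘ nthItemFn ∘ fanoutFn (nthF 1) (sndF ∘ nthF 0))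

/-- `litCF ∈ FP`. [folklore] -/
theorem litCF_mem_FP : litCF ∈ FP :=
  comp_mem_FP nthItemFn_mem_FP (fanoutFn_mem_FP (sndPow_mem_FP 1)
    (comp_mem_FP sndF_mem_FP (comp_mem_FP nthItemFn_mem_FP
      (fanoutFn_mem_FP (nthF_mem_FP 1) (comp_mem_FP sndF_mem_FP (nthF_mem_FP 0))))))

/-- **Value of `litCF`**: the code `⟨bin v, [b]⟩` of `litAt ψ c l` for `c < m`, `l < |ψ[c]|`. [cite: AroraBarak2009, §1.3 (loops)] -/
theorem litCF_encode {c l : ℕ} (hc : c < ψ.length) (hl : l < (ψ[c]).length) :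
    litCF (boolPair (encodingCNF.encode ψ) (boolPair (ones c) (ones l))) =
      boolPair (encodeNat (litAt ψ c l).1) [(litAt ψ c l).2] := by
  have h1 : litAt ψ c l = (ψ[c])[l] := by
    unfold litAt; rw [List.getD_eq_getElem _ _ hc, List.getD_eq_getElem _ _ hl]
  simp only [litCF, Function.comp_apply, fanoutFn_apply, sndPow_succ_boolPair, sndPow_zero_boolPair,
    nthF_succ_boolPair, nthF_zero_boolPair, encode_eq, sndF_boolPair, nthItemFn_body, List.getD_eq_getElem?_getD,
    List.getElem?_map, List.getElem?_eq_getElem hc, Option.map_some, Option.getD_some, encode_clause_eq,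
    List.getElem?_eq_getElem hl, encode_literal, h1]

/-- **The polarity bit of the literal `l` of clause `c`**, on `⟨⌜ψ⌝, ⟨1ᶜ, 1ˡ⟩⟩`. [folklore] -/
def polCF : List Bool → List Bool := headBitFn ∘ sndF ∘ litCF

/-- `polCF ∈ FP`. [folklore] -/
theorem polCF_mem_FP : polCF ∈ FP := comp_mem_FP headBitFn_mem_FP (comp_mem_FP sndF_mem_FP litCF_mem_FP)

/-- `polCF` is one-bit. [folklore] -/
theorem oneBit_polCF : OneBit polCF := oneBit_headBitFn.comp _

/-- Value of `polCF` on a 3CNF. [folklore] -/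
theorem polCF_encode (hw : CNF.IsWidthEq 3 ψ) {c l : ℕ} (hc : c < ψ.length) (hl : l < 3) :
    polCF (boolPair (encodingCNF.encode ψ) (boolPair (ones c) (ones l))) = [(litAt ψ c l).2] := by
  have hl' : l < (ψ[c]).length := by rw [hw _ (List.getElem_mem hc)]; exact hl
  rw [polCF, Function.comp_apply, Function.comp_apply, litCF_encode ψ hc hl', sndF_boolPair, headBitFn_apply]
  rfl

/-! ### The constant weights of a clause block: `w3cF` -/

section W3c

/-- `[b = 7]` on `⟨x₀, ⟨1ʲ, ⟨1ᵃ, 1ᵇ⟩⟩⟩`. [folklore] -/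
def cB7 : List Bool → List Bool := uEqF ∘ fanoutFn (sndPow 2) fun _ => ones 7
/-- `[a = 0]`. [folklore] -/
def cA0 : List Bool → List Bool := isNilFn ∘ nthF 2
/-- `[a = 6]`. [folklore] -/
def cA6 : List Bool → List Bool := uEqF ∘ fanoutFn (nthF 2) fun _ => ones 6
/-- `[b < 7]`. [folklore] -/
def cBlt7 : List Bool → List Bool := uLtF ∘ fanoutFn (sndPow 2) fun _ => ones 7
/-- `[a + 1 = b]`. [folklore] -/
def cA1B : List Bool → List Bool := uEqF ∘ fanoutFn (List.cons true ∘ nthF 2) (sndPow 2)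
/-- `[a + 2 = b]`. [folklore] -/
def cA2B : List Bool → List Bool := uEqF ∘ fanoutFn (List.cons true ∘ List.cons true ∘ nthF 2) (sndPow 2)
/-- `⟨1^{b/2}, 1^{b mod 2}⟩`. [folklore] -/
def halfB : List Bool → List Bool := qrF 2 ∘ sndPow 2
/-- `[b mod 2 = 1]`. [folklore] -/
def cBodd : List Bool → List Bool := uEqF ∘ fanoutFn (sndF ∘ halfB) fun _ => [true]
/-- `[b mod 2 = 0]`. [folklore] -/
def cBeven : List Bool → List Bool := isNilFn ∘ sndF ∘ halfB
/-- `[0 < b]`. [folklore] -/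
def cBpos : List Bool → List Bool := notFn (isNilFn ∘ sndPow 2)
/-- The polarity of literal `b/2` of clause `j`. [folklore] -/
def pol1 : List Bool → List Bool := polCF ∘ fanoutFn (nthF 0) (fanoutFn (nthF 1) (fstF ∘ halfB))
/-- The polarity of literal `b/2 - 1` of clause `j`. [folklore] -/
def pol2 : List Bool → List Bool :=
  polCF ∘ fanoutFn (nthF 0) (fanoutFn (nthF 1) (uSubF ∘ fanoutFn (fun _ => [true]) (fstF ∘ halfB)))

/-- **The constant weight `w3c` of the edge `a → b` of clause block `j`**, on `⟨⌜ψ⌝, ⟨1ʲ, ⟨1ᵃ, 1ᵇ⟩⟩⟩`,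
as a `zcode` (the if-tree of `ThreeCNFPer.w3c`). [cite: Valiant1979, Lemma 3.1] -/
def w3cF : List Bool → List Bool :=
  iteFn cB7 (iteFn cA0 (fun _ => [true]) (iteFn cA6 (fun _ => [true, true]) fun _ => []))
    (iteFn (andFn cBlt7 (andFn cA1B cBodd)) (iteFn pol1 (fun _ => [true, true]) fun _ => [true])
      (iteFn (andFn cBlt7 (andFn cA2B (andFn cBeven cBpos))) (iteFn pol2 (fun _ => [true]) fun _ => [])
        fun _ => []))

/-- `w3cF ∈ FP`. [folklore] -/
theorem w3cF_mem_FP : w3cF ∈ FP := by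
  have hB7 : cB7 ∈ FP := comp_mem_FP uEqF_mem_FP (fanoutFn_mem_FP (sndPow_mem_FP 2) (const_mem_FP _))
  have hA0 : cA0 ∈ FP := comp_mem_FP isNilFn_mem_FP (nthF_mem_FP 2)
  have hA6 : cA6 ∈ FP := comp_mem_FP uEqF_mem_FP (fanoutFn_mem_FP (nthF_mem_FP 2) (const_mem_FP _))
  have hBlt7 : cBlt7 ∈ FP := comp_mem_FP uLtF_mem_FP (fanoutFn_mem_FP (sndPow_mem_FP 2) (const_mem_FP _))
  have hA1B : cA1B ∈ FP := comp_mem_FP uEqF_mem_FP (fanoutFn_mem_FP (comp_mem_FP (cons_mem_FP true) (nthF_mem_FP 2)) (sndPow_mem_FP 2))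
  have hA2B : cA2B ∈ FP := comp_mem_FP uEqF_mem_FP (fanoutFn_mem_FP
    (comp_mem_FP (cons_mem_FP true) (comp_mem_FP (cons_mem_FP true) (nthF_mem_FP 2))) (sndPow_mem_FP 2))
  have hhalf : halfB ∈ FP := comp_mem_FP (qrF_mem_FP 2) (sndPow_mem_FP 2)
  have hodd : cBodd ∈ FP := comp_mem_FP uEqF_mem_FP (fanoutFn_mem_FP (comp_mem_FP sndF_mem_FP hhalf) (const_mem_FP _))
  have heven : cBeven ∈ FP := comp_mem_FP isNilFn_mem_FP (comp_mem_FP sndF_mem_FP hhalf)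
  have hpos : cBpos ∈ FP := notFn_mem_FP (comp_mem_FP isNilFn_mem_FP (sndPow_mem_FP 2))
  have hp1 : pol1 ∈ FP := comp_mem_FP polCF_mem_FP (fanoutFn_mem_FP (nthF_mem_FP 0)
    (fanoutFn_mem_FP (nthF_mem_FP 1) (comp_mem_FP fstF_mem_FP hhalf)))
  have hp2 : pol2 ∈ FP := comp_mem_FP polCF_mem_FP (fanoutFn_mem_FP (nthF_mem_FP 0)
    (fanoutFn_mem_FP (nthF_mem_FP 1) (comp_mem_FP uSubF_mem_FP (fanoutFn_mem_FP (const_mem_FP _) (comp_mem_FP fstF_mem_FP hhalf)))))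
  exact iteFn_mem_FP hB7 (iteFn_mem_FP hA0 (const_mem_FP _) (iteFn_mem_FP hA6 (const_mem_FP _) (const_mem_FP _)))
    (iteFn_mem_FP (andFn_mem_FP hBlt7 (andFn_mem_FP hA1B hodd)) (iteFn_mem_FP hp1 (const_mem_FP _) (const_mem_FP _))
      (iteFn_mem_FP (andFn_mem_FP hBlt7 (andFn_mem_FP hA2B (andFn_mem_FP heven hpos)))
        (iteFn_mem_FP hp2 (const_mem_FP _) (const_mem_FP _)) (const_mem_FP _)))

/-- `ones a = [] ↔ a = 0`. [folklore] -/
theorem ones_eq_nil_iff (a : ℕ) : ones a = [] ↔ a = 0 := by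
  cases a <;> simp [ones, List.replicate_succ]

/-- **Value of `w3cF`** on a clause `j < m` of a 3CNF. [cite: Valiant1979, Lemma 3.1] -/
theorem w3cF_encode (hw : CNF.IsWidthEq 3 ψ) {j : ℕ} (hj : j < ψ.length) (a b : ℕ) :
    w3cF (boolPair (encodingCNF.encode ψ) (boolPair (ones j) (boolPair (ones a) (ones b)))) =
      zcode (w3c (k := ℤ) (fun i => (litAt ψ j i).2) a b) := by
  set r := boolPair (encodingCNF.encode ψ) (boolPair (ones j) (boolPair (ones a) (ones b))) with hr
  have eB7 : cB7 r = [decide (b = 7)] := by simp [cB7, hr]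
  have eA0 : cA0 r = [decide (a = 0)] := by simp [cA0, hr, isNilFn]
  have eA6 : cA6 r = [decide (a = 6)] := by simp [cA6, hr]
  have eBlt7 : cBlt7 r = [decide (b < 7)] := by simp [cBlt7, hr]
  have eA1B : cA1B r = [decide (a + 1 = b)] := by
    simp only [cA1B, hr, Function.comp_apply, fanoutFn_apply, nthF_succ_boolPair, nthF_zero_boolPair,
      sndPow_succ_boolPair, sndPow_zero_boolPair, true_cons_ones, uEqF_ones]
  have eA2B : cA2B r = [decide (a + 2 = b)] := by
    simp only [cA2B, hr, Function.comp_apply, fanoutFn_apply, nthF_succ_boolPair, nthF_zero_boolPair,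
      sndPow_succ_boolPair, sndPow_zero_boolPair, true_cons_ones, uEqF_ones]
  have ehalf : halfB r = boolPair (ones (b / 2)) (ones (b % 2)) := by simp [halfB, hr]
  have eodd : cBodd r = [decide (b % 2 = 1)] := by
    simp only [cBodd, Function.comp_apply, fanoutFn_apply, ehalf, sndF_boolPair]
    rw [show ([true] : List Bool) = ones 1 from rfl, uEqF_ones]
  have eeven : cBeven r = [decide (b % 2 = 0)] := by
    simp only [cBeven, Function.comp_apply, ehalf, sndF_boolPair, isNilFn, ones_eq_nil_iff]
  have epos : cBpos r = [decide (0 < b)] := by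
    rw [cBpos, notFn_apply (b := decide (b = 0)) (by simp [hr, isNilFn])]
    congr 1
    rw [Bool.eq_iff_iff]; simp [Nat.pos_iff_ne_zero]
  have eC1 : andFn cBlt7 (andFn cA1B cBodd) r = [decide (b < 7 ∧ a + 1 = b ∧ b % 2 = 1)] := by
    rw [andFn_apply eBlt7 (andFn_apply eA1B eodd)]; simp only [Bool.decide_and]
  have eC2 : andFn cBlt7 (andFn cA2B (andFn cBeven cBpos)) r =
      [decide (b < 7 ∧ a + 2 = b ∧ b % 2 = 0 ∧ 0 < b)] := by
    rw [andFn_apply eBlt7 (andFn_apply eA2B (andFn_apply eeven epos))]; simp only [Bool.decide_and]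
  unfold w3cF w3c
  rw [iteFn_decide eB7]
  by_cases h7 : b = 7
  · rw [if_pos h7, if_pos h7, iteFn_decide eA0]
    by_cases h0 : a = 0
    · rw [if_pos h0, if_pos h0, if_neg (by omega)]; rfl
    · rw [if_neg h0, if_neg h0, iteFn_decide eA6]
      by_cases h6 : a = 6
      · rw [if_pos h6, if_pos h6]; rfl
      · rw [if_neg h6, if_neg h6]; rfl
  rw [if_neg h7, if_neg h7, iteFn_decide eC1]
  by_cases h1 : b < 7 ∧ a + 1 = b ∧ b % 2 = 1
  · rw [if_pos h1, if_pos h1]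
    have hl : b / 2 < 3 := by omega
    have ep : pol1 r = [(litAt ψ j (b / 2)).2] := by
      have e0 : nthF 0 r = encodingCNF.encode ψ := by simp [hr]
      have e1 : nthF 1 r = ones j := by simp [hr]
      simp only [pol1, Function.comp_apply, fanoutFn_apply, e0, e1, ehalf, fstF_boolPair]
      exact polCF_encode ψ hw hj hl
    rw [iteFn_apply ep]
    show _ = zcode (if (litAt ψ j (b / 2)).2 = true then -1 else 1)
    cases (litAt ψ j (b / 2)).2 <;> rfl
  rw [if_neg h1, if_neg h1, iteFn_decide eC2]
  by_cases h2 : b < 7 ∧ a + 2 = b ∧ b % 2 = 0 ∧ 0 < b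
  · rw [if_pos h2, if_pos h2]
    have hl : b / 2 - 1 < 3 := by omega
    have ep : pol2 r = [(litAt ψ j (b / 2 - 1)).2] := by
      have e0 : nthF 0 r = encodingCNF.encode ψ := by simp [hr]
      have e1 : nthF 1 r = ones j := by simp [hr]
      simp only [pol2, Function.comp_apply, fanoutFn_apply, e0, e1, ehalf, fstF_boolPair]
      rw [show ([true] : List Bool) = ones 1 from rfl, uSubF_ones]
      exact polCF_encode ψ hw hj hl
    rw [iteFn_apply ep]
    show _ = zcode (if (litAt ψ j (b / 2 - 1)).2 = true then 1 else 0)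
    cases (litAt ψ j (b / 2 - 1)).2 <;> rfl
  rw [if_neg h2, if_neg h2]
  rfl

end W3c

/-! ### The constant clause-block entries: `hConstF` -/

section HConst

/-- `[r = c + 1]` on `⟨x₀, ⟨1ʳ, 1ᶜ⟩⟩`. [folklore] -/
def cRC1 : List Bool → List Bool := uEqF ∘ fanoutFn (nthF 1) (List.cons true ∘ sndPow 1)
/-- `[r ≤ c]`. [folklore] -/
def cRleC : List Bool → List Bool := uLeF ∘ fanoutFn (nthF 1) (sndPow 1)
/-- `1^{c/7}` (the clause block of the column). [folklore] -/
def blkJ : List Bool → List Bool := fstF ∘ qrF 7 ∘ sndPow 1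
/-- `[c/7 < m]`. [folklore] -/
def cJm : List Bool → List Bool := uLtF ∘ fanoutFn blkJ (fstF ∘ nthF 0)
/-- `1^{7 (c/7)}`. [folklore] -/
def sevenJ : List Bool → List Bool := polyFn (7 * X) ∘ blkJ
/-- `[7 (c/7) ≤ r]`. [folklore] -/
def c7JR : List Bool → List Bool := uLeF ∘ fanoutFn sevenJ (nthF 1)
/-- The local coordinates `⟨1^{r - 7j}, 1^{c + 1 - 7j}⟩` and the call of `w3cF`. [folklore] -/
def w3cCall : List Bool → List Bool :=
  w3cF ∘ fanoutFn (nthF 0) (fanoutFn blkJ (fanoutFn (uSubF ∘ fanoutFn sevenJ (nthF 1))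
    (uSubF ∘ fanoutFn sevenJ (List.cons true ∘ sndPow 1))))

/-- **The constant clause-block entry `hConst r c`** on `⟨⌜ψ⌝, ⟨1ʳ, 1ᶜ⟩⟩`, as a `zcode`
(the if-tree of `ThreeCNFPer.hConst`). [cite: Valiant1979, Lemma 3.1] -/
def hConstF : List Bool → List Bool :=
  iteFn cRC1 (fun _ => [true]) (iteFn cRleC (iteFn (andFn cJm c7JR) w3cCall fun _ => []) fun _ => [])

/-- `hConstF ∈ FP`. [folklore] -/
theorem hConstF_mem_FP : hConstF ∈ FP := by
  have hJ : blkJ ∈ FP := comp_mem_FP fstF_mem_FP (comp_mem_FP (qrF_mem_FP 7) (sndPow_mem_FP 1))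
  have h7J : sevenJ ∈ FP := comp_mem_FP (polyFn_mem_FP _) hJ
  refine iteFn_mem_FP (comp_mem_FP uEqF_mem_FP (fanoutFn_mem_FP (nthF_mem_FP 1)
    (comp_mem_FP (cons_mem_FP true) (sndPow_mem_FP 1)))) (const_mem_FP _)
    (iteFn_mem_FP (comp_mem_FP uLeF_mem_FP (fanoutFn_mem_FP (nthF_mem_FP 1) (sndPow_mem_FP 1)))
      (iteFn_mem_FP (andFn_mem_FP (comp_mem_FP uLtF_mem_FP (fanoutFn_mem_FP hJ (comp_mem_FP fstF_mem_FP (nthF_mem_FP 0))))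
        (comp_mem_FP uLeF_mem_FP (fanoutFn_mem_FP h7J (nthF_mem_FP 1)))) ?_ (const_mem_FP _)) (const_mem_FP _))
  exact comp_mem_FP w3cF_mem_FP (fanoutFn_mem_FP (nthF_mem_FP 0) (fanoutFn_mem_FP hJ
    (fanoutFn_mem_FP (comp_mem_FP uSubF_mem_FP (fanoutFn_mem_FP h7J (nthF_mem_FP 1)))
      (comp_mem_FP uSubF_mem_FP (fanoutFn_mem_FP h7J (comp_mem_FP (cons_mem_FP true) (sndPow_mem_FP 1)))))))

/-- **Value of `hConstF`** on a 3CNF. [cite: Valiant1979, Lemma 3.1] -/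
theorem hConstF_encode (hw : CNF.IsWidthEq 3 ψ) (r c : ℕ) :
    hConstF (boolPair (encodingCNF.encode ψ) (boolPair (ones r) (ones c))) = zcode (hConst ψ r c) := by
  set z := boolPair (encodingCNF.encode ψ) (boolPair (ones r) (ones c)) with hz
  have eRC1 : cRC1 z = [decide (r = c + 1)] := by
    simp only [cRC1, hz, Function.comp_apply, fanoutFn_apply, nthF_succ_boolPair, nthF_zero_boolPair,
      sndPow_succ_boolPair, sndPow_zero_boolPair, true_cons_ones, uEqF_ones]
  have eRleC : cRleC z = [decide (r ≤ c)] := by simp [cRleC, hz]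
  have eJ : blkJ z = ones (c / 7) := by simp [blkJ, hz]
  have em : fstF (nthF 0 z) = ones ψ.length := by simp [hz, encode_eq]
  have eJm : cJm z = [decide (c / 7 < ψ.length)] := by
    simp only [cJm, Function.comp_apply, fanoutFn_apply, eJ, em, uLtF_ones]
  have e7J : sevenJ z = ones (7 * (c / 7)) := by simp [sevenJ, eJ]
  have e0 : nthF 0 z = encodingCNF.encode ψ := by simp [hz]
  have e1 : nthF 1 z = ones r := by simp [hz]
  have e2 : sndPow 1 z = ones c := by simp [hz]
  have e7JR : c7JR z = [decide (7 * (c / 7) ≤ r)] := by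
    simp only [c7JR, Function.comp_apply, fanoutFn_apply, e7J, e1, uLeF_ones]
  have eC : andFn cJm c7JR z = [decide (c / 7 < ψ.length ∧ 7 * (c / 7) ≤ r)] := by
    rw [andFn_apply eJm e7JR]; simp only [Bool.decide_and]
  have eCall : w3cCall z = w3cF (boolPair (encodingCNF.encode ψ) (boolPair (ones (c / 7))
      (boolPair (ones (r - 7 * (c / 7))) (ones (c + 1 - 7 * (c / 7)))))) := by
    simp only [w3cCall, Function.comp_apply, fanoutFn_apply, eJ, e7J, e0, e1, e2, true_cons_ones, uSubF_ones]
  unfold hConstF hConst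
  rw [iteFn_decide eRC1]
  by_cases h1 : r = c + 1
  · rw [if_pos h1, if_pos h1]; rfl
  rw [if_neg h1, if_neg h1, iteFn_decide eRleC]
  by_cases h2 : r ≤ c
  · rw [if_pos h2, if_pos h2, iteFn_decide eC]
    by_cases h3 : c / 7 < ψ.length ∧ 7 * (c / 7) ≤ r
    · rw [if_pos h3, if_pos h3, eCall, w3cF_encode ψ hw h3.1]
    · rw [if_neg h3, if_neg h3]; rfl
  · rw [if_neg h2, if_neg h2]; rfl

end HConst

/-! ### The two `4 × 4` tables -/

section Tables

/-- `[g = i]` for a constant `i`, on `⟨1ᵍ, 1ᵍ'⟩` (first field). [folklore] -/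
def cG (i : ℕ) : List Bool → List Bool := uEqF ∘ fanoutFn fstF fun _ => ones i
/-- `[g' = i]` (second field). [folklore] -/
def cG' (i : ℕ) : List Bool → List Bool := uEqF ∘ fanoutFn sndF fun _ => ones i
/-- `[g' ≤ g]`. [folklore] -/
def cG'leG : List Bool → List Bool := uLeF ∘ fanoutFn sndF fstF
/-- `[g' ≤ 1]`. [folklore] -/
def cG'le1 : List Bool → List Bool := uLeF ∘ fanoutFn sndF fun _ => ones 1

/-- **The table `E(0,0,0)`** on `⟨1ᵍ, 1ᵍ'⟩`, as a `zcode` (the if-tree of `PerRed.e3c`). [folklore] -/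
def e3cF : List Bool → List Bool :=
  iteFn (cG 3) (iteFn (cG' 3) (fun _ => []) fun _ => [true])
    (iteFn (cG' 3) (fun _ => [true]) (iteFn cG'leG (fun _ => []) fun _ => [true, true]))

/-- **The two-site core** on `⟨1ᵍ, 1ᵍ'⟩`, as a `zcode` (the if-tree of `PerRed.coreC`). [folklore] -/
def coreCF : List Bool → List Bool :=
  iteFn (cG 0) (iteFn (orFn (cG' 0) (cG' 2)) (fun _ => [true]) fun _ => [])
    (iteFn (cG 1) (iteFn (cG' 1) (fun _ => [true]) (iteFn (cG' 3) (fun _ => [true, true]) fun _ => []))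
      (iteFn (cG 2) (iteFn cG'le1 (fun _ => [true]) fun _ => [true, true]) fun _ => [true, true]))
where
  /-- disjunction of one-bit conditions -/
  orFn (c d : List Bool → List Bool) : List Bool → List Bool := iteFn c (fun _ => [true]) d

/-- `e3cF ∈ FP`. [folklore] -/
theorem e3cF_mem_FP : e3cF ∈ FP := by
  have hG : ∀ i, cG i ∈ FP := fun i => comp_mem_FP uEqF_mem_FP (fanoutFn_mem_FP fstF_mem_FP (const_mem_FP _))
  have hG' : ∀ i, cG' i ∈ FP := fun i => comp_mem_FP uEqF_mem_FP (fanoutFn_mem_FP sndF_mem_FP (const_mem_FP _))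
  exact iteFn_mem_FP (hG 3) (iteFn_mem_FP (hG' 3) (const_mem_FP _) (const_mem_FP _))
    (iteFn_mem_FP (hG' 3) (const_mem_FP _) (iteFn_mem_FP (comp_mem_FP uLeF_mem_FP (fanoutFn_mem_FP sndF_mem_FP fstF_mem_FP))
      (const_mem_FP _) (const_mem_FP _)))

/-- `coreCF ∈ FP`. [folklore] -/
theorem coreCF_mem_FP : coreCF ∈ FP := by
  have hG : ∀ i, cG i ∈ FP := fun i => comp_mem_FP uEqF_mem_FP (fanoutFn_mem_FP fstF_mem_FP (const_mem_FP _))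
  have hG' : ∀ i, cG' i ∈ FP := fun i => comp_mem_FP uEqF_mem_FP (fanoutFn_mem_FP sndF_mem_FP (const_mem_FP _))
  exact iteFn_mem_FP (hG 0) (iteFn_mem_FP (iteFn_mem_FP (hG' 0) (const_mem_FP _) (hG' 2)) (const_mem_FP _) (const_mem_FP _))
    (iteFn_mem_FP (hG 1) (iteFn_mem_FP (hG' 1) (const_mem_FP _) (iteFn_mem_FP (hG' 3) (const_mem_FP _) (const_mem_FP _)))
      (iteFn_mem_FP (hG 2) (iteFn_mem_FP (comp_mem_FP uLeF_mem_FP (fanoutFn_mem_FP sndF_mem_FP (const_mem_FP _)))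
        (const_mem_FP _) (const_mem_FP _)) (const_mem_FP _)))

/-- **Value of `e3cF`.** [folklore] -/
theorem e3cF_ones (g g' : ℕ) : e3cF (boolPair (ones g) (ones g')) = zcode (PerRed.e3c g g') := by
  have eG : ∀ i, cG i (boolPair (ones g) (ones g')) = [decide (g = i)] := fun i => by simp [cG]
  have eG' : ∀ i, cG' i (boolPair (ones g) (ones g')) = [decide (g' = i)] := fun i => by simp [cG']
  have ele : cG'leG (boolPair (ones g) (ones g')) = [decide (g' ≤ g)] := by simp [cG'leG]
  unfold e3cF PerRed.e3c
  rw [iteFn_decide (eG 3)]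
  by_cases h1 : g = 3
  · rw [if_pos h1, if_pos h1, iteFn_decide (eG' 3)]
    by_cases h2 : g' = 3
    · rw [if_pos h2, if_pos h2]; rfl
    · rw [if_neg h2, if_neg h2]; rfl
  rw [if_neg h1, if_neg h1, iteFn_decide (eG' 3)]
  by_cases h2 : g' = 3
  · rw [if_pos h2, if_pos h2]; rfl
  rw [if_neg h2, if_neg h2, iteFn_decide ele]
  by_cases h3 : g' ≤ g
  · rw [if_pos h3, if_pos h3]; rfl
  · rw [if_neg h3, if_neg h3]; rfl

/-- **Value of `coreCF`.** [folklore] -/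
theorem coreCF_ones (g g' : ℕ) : coreCF (boolPair (ones g) (ones g')) = zcode (PerRed.coreC g g') := by
  have eG : ∀ i, cG i (boolPair (ones g) (ones g')) = [decide (g = i)] := fun i => by simp [cG]
  have eG' : ∀ i, cG' i (boolPair (ones g) (ones g')) = [decide (g' = i)] := fun i => by simp [cG']
  have ele : cG'le1 (boolPair (ones g) (ones g')) = [decide (g' ≤ 1)] := by
    simp only [cG'le1, Function.comp_apply, fanoutFn_apply, sndF_boolPair, uLeF_ones]
  have eor : coreCF.orFn (cG' 0) (cG' 2) (boolPair (ones g) (ones g')) = [decide (g' = 0 ∨ g' = 2)] := by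
    unfold coreCF.orFn
    rw [iteFn_decide (eG' 0)]
    by_cases h : g' = 0
    · rw [if_pos h]; simp [h]
    · rw [if_neg h, eG' 2]; simp [h]
  unfold coreCF PerRed.coreC
  rw [iteFn_decide (eG 0)]
  by_cases h0 : g = 0
  · rw [if_pos h0, if_pos h0, iteFn_decide eor]
    by_cases h : g' = 0 ∨ g' = 2
    · rw [if_pos h, if_pos h]; rfl
    · rw [if_neg h, if_neg h]; rfl
  rw [if_neg h0, if_neg h0, iteFn_decide (eG 1)]
  by_cases h1 : g = 1
  · rw [if_pos h1, if_pos h1, iteFn_decide (eG' 1)]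
    by_cases h : g' = 1
    · rw [if_pos h, if_pos h]; rfl
    · rw [if_neg h, if_neg h, iteFn_decide (eG' 3)]
      by_cases h' : g' = 3
      · rw [if_pos h', if_pos h']; rfl
      · rw [if_neg h', if_neg h']; rfl
  rw [if_neg h1, if_neg h1, iteFn_decide (eG 2)]
  by_cases h2 : g = 2
  · rw [if_pos h2, if_pos h2, iteFn_decide ele]
    by_cases h : g' ≤ 1
    · rw [if_pos h, if_pos h]; rfl
    · rw [if_neg h, if_neg h]; rfl
  · rw [if_neg h2, if_neg h2]; rfl

end Tables

/-! ### The base matrix entries: `baseEntryF` -/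

section Base

/-- `1^{7m}` from `⟨x₀, …⟩`. [folklore] -/
def m7F : List Bool → List Bool := polyFn (7 * X) ∘ fstF ∘ nthF 0
/-- `[x < 7m]`. [folklore] -/
def cX7 : List Bool → List Bool := uLtF ∘ fanoutFn (nthF 1) m7F
/-- `[y < 7m]`. [folklore] -/
def cY7 : List Bool → List Bool := uLtF ∘ fanoutFn (sndPow 1) m7F
/-- `⟨1^{(x-7m)/4}, 1^{(x-7m) mod 4}⟩`. [folklore] -/
def dxF : List Bool → List Bool := qrF 4 ∘ uSubF ∘ fanoutFn m7F (nthF 1)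
/-- `⟨1^{(y-7m)/4}, 1^{(y-7m) mod 4}⟩`. [folklore] -/
def dyF : List Bool → List Bool := qrF 4 ∘ uSubF ∘ fanoutFn m7F (sndPow 1)
/-- `[(x-7m)/4 = (y-7m)/4]`. [folklore] -/
def cPP : List Bool → List Bool := uEqF ∘ fanoutFn (fstF ∘ dxF) (fstF ∘ dyF)

/-- **The base matrix entry `baseEntry x y`** on `⟨⌜ψ⌝, ⟨1ˣ, 1ʸ⟩⟩`, as a `zcode`
(the if-tree of `PerRed.baseEntry`). [cite: Valiant1979, Lemma 3.1] -/
def baseEntryF : List Bool → List Bool :=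
  iteFn cX7 (iteFn cY7 hConstF fun _ => []) (iteFn cY7 (fun _ => [])
    (iteFn cPP (e3cF ∘ fanoutFn (sndF ∘ dxF) (sndF ∘ dyF)) fun _ => []))

/-- `baseEntryF ∈ FP`. [folklore] -/
theorem baseEntryF_mem_FP : baseEntryF ∈ FP := by
  have h7 : m7F ∈ FP := comp_mem_FP (polyFn_mem_FP _) (comp_mem_FP fstF_mem_FP (nthF_mem_FP 0))
  have hX : cX7 ∈ FP := comp_mem_FP uLtF_mem_FP (fanoutFn_mem_FP (nthF_mem_FP 1) h7)
  have hY : cY7 ∈ FP := comp_mem_FP uLtF_mem_FP (fanoutFn_mem_FP (sndPow_mem_FP 1) h7)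
  have hdx : dxF ∈ FP := comp_mem_FP (qrF_mem_FP 4) (comp_mem_FP uSubF_mem_FP (fanoutFn_mem_FP h7 (nthF_mem_FP 1)))
  have hdy : dyF ∈ FP := comp_mem_FP (qrF_mem_FP 4) (comp_mem_FP uSubF_mem_FP (fanoutFn_mem_FP h7 (sndPow_mem_FP 1)))
  exact iteFn_mem_FP hX (iteFn_mem_FP hY hConstF_mem_FP (const_mem_FP _)) (iteFn_mem_FP hY (const_mem_FP _)
    (iteFn_mem_FP (comp_mem_FP uEqF_mem_FP (fanoutFn_mem_FP (comp_mem_FP fstF_mem_FP hdx) (comp_mem_FP fstF_mem_FP hdy)))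
      (comp_mem_FP e3cF_mem_FP (fanoutFn_mem_FP (comp_mem_FP sndF_mem_FP hdx) (comp_mem_FP sndF_mem_FP hdy)))
      (const_mem_FP _)))

/-- **Value of `baseEntryF`.** [cite: Valiant1979, Lemma 3.1] -/
theorem baseEntryF_encode (hw : CNF.IsWidthEq 3 ψ) (x y : ℕ) :
    baseEntryF (boolPair (encodingCNF.encode ψ) (boolPair (ones x) (ones y))) = zcode (PerRed.baseEntry ψ x y) := by
  set z := boolPair (encodingCNF.encode ψ) (boolPair (ones x) (ones y)) with hz
  have e7 : m7F z = ones (7 * ψ.length) := by simp [m7F, hz, encode_eq]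
  have e1 : nthF 1 z = ones x := by simp [hz]
  have e2 : sndPow 1 z = ones y := by simp [hz]
  have eX : cX7 z = [decide (x < 7 * ψ.length)] := by
    simp only [cX7, Function.comp_apply, fanoutFn_apply, e1, e7, uLtF_ones]
  have eY : cY7 z = [decide (y < 7 * ψ.length)] := by
    simp only [cY7, Function.comp_apply, fanoutFn_apply, e2, e7, uLtF_ones]
  have edx : dxF z = boolPair (ones ((x - 7 * ψ.length) / 4)) (ones ((x - 7 * ψ.length) % 4)) := by
    simp only [dxF, Function.comp_apply, fanoutFn_apply, e7, e1, uSubF_ones, qrF_ones]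
  have edy : dyF z = boolPair (ones ((y - 7 * ψ.length) / 4)) (ones ((y - 7 * ψ.length) % 4)) := by
    simp only [dyF, Function.comp_apply, fanoutFn_apply, e7, e2, uSubF_ones, qrF_ones]
  have ePP : cPP z = [decide ((x - 7 * ψ.length) / 4 = (y - 7 * ψ.length) / 4)] := by
    simp only [cPP, Function.comp_apply, fanoutFn_apply, edx, edy, fstF_boolPair, uEqF_ones]
  unfold baseEntryF PerRed.baseEntry
  rw [iteFn_decide eX]
  by_cases h1 : x < 7 * ψ.length
  · rw [if_pos h1, if_pos h1, iteFn_decide eY]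
    by_cases h2 : y < 7 * ψ.length
    · rw [if_pos h2, if_pos h2, hz, hConstF_encode ψ hw]
    · rw [if_neg h2, if_neg h2]; rfl
  rw [if_neg h1, if_neg h1, iteFn_decide eY]
  by_cases h2 : y < 7 * ψ.length
  · rw [if_pos h2, if_pos h2]; rfl
  rw [if_neg h2, if_neg h2, iteFn_decide ePP]
  by_cases h3 : (x - 7 * ψ.length) / 4 = (y - 7 * ψ.length) / 4
  · rw [if_pos h3, if_pos h3]
    simp only [Function.comp_apply, fanoutFn_apply, edx, edy, sndF_boolPair, e3cF_ones]
  · rw [if_neg h3, if_neg h3]; rfl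

end Base

/-! ### The variable of an occurrence and the first-hit fold (`nextPos`) -/

section NextPos

/-- **The variable numeral of the occurrence `o = 3c + l`**, on `⟨⌜ψ⌝, 1ᵒ⟩`. [folklore] -/
def varOF : List Bool → List Bool := fstF ∘ litCF ∘ fanoutFn fstF (qrF 3 ∘ sndF)

/-- `varOF ∈ FP`. [folklore] -/
theorem varOF_mem_FP : varOF ∈ FP :=
  comp_mem_FP fstF_mem_FP (comp_mem_FP litCF_mem_FP (fanoutFn_mem_FP fstF_mem_FP (comp_mem_FP (qrF_mem_FP 3) sndF_mem_FP)))

/-- Value of `varOF` on an occurrence `o < 3m` of a 3CNF. [folklore] -/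
theorem varOF_encode (hw : CNF.IsWidthEq 3 ψ) {o : ℕ} (ho : o < ψ.length * 3) :
    varOF (boolPair (encodingCNF.encode ψ) (ones o)) = encodeNat (varAt ψ o) := by
  have hc : o / 3 < ψ.length := by omega
  have hl : o % 3 < (ψ[o / 3]).length := by rw [hw _ (List.getElem_mem hc)]; omega
  simp only [varOF, Function.comp_apply, fanoutFn_apply, fstF_boolPair, sndF_boolPair, qrF_ones,
    litCF_encode ψ hc hl, varAt]

/-- **`[var p = var q]`** on `⟨⟨⌜ψ⌝, 1ᵖ⟩, 1^q⟩` (the shape a fold piece sees). [folklore] -/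
def varEqPQ : List Bool → List Bool :=
  eqPairFn ∘ fanoutFn (varOF ∘ fstF) (varOF ∘ fanoutFn (fstF ∘ fstF) sndF)

/-- `varEqPQ ∈ FP`. [folklore] -/
theorem varEqPQ_mem_FP : varEqPQ ∈ FP :=
  comp_mem_FP eqPairFn_mem_FP (fanoutFn_mem_FP (comp_mem_FP varOF_mem_FP fstF_mem_FP)
    (comp_mem_FP varOF_mem_FP (fanoutFn_mem_FP (comp_mem_FP fstF_mem_FP fstF_mem_FP) sndF_mem_FP)))

/-- `varEqPQ` is one-bit. [folklore] -/
theorem oneBit_varEqPQ : OneBit varEqPQ := oneBit_eqPairFn.comp _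

/-- Value of `varEqPQ`. [folklore] -/
theorem varEqPQ_encode (hw : CNF.IsWidthEq 3 ψ) {p q : ℕ} (hp : p < ψ.length * 3) (hq : q < ψ.length * 3) :
    varEqPQ (boolPair (boolPair (encodingCNF.encode ψ) (ones p)) (ones q)) = [decide (varAt ψ q = varAt ψ p)] := by
  simp only [varEqPQ, Function.comp_apply, fanoutFn_apply, fstF_boolPair, sndF_boolPair, varOF_encode ψ hw hp,
    varOF_encode ψ hw hq, eqPairFn_boolPair]
  rw [Bool.decide_congr encodeNat_inj]
  congr 1
  rw [Bool.decide_congr (show varAt ψ p = varAt ψ q ↔ varAt ψ q = varAt ψ p from ⟨Eq.symm, Eq.symm⟩)]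

/-- **The first-hit accumulator**: keep the accumulator once it is nonempty, otherwise take the
piece: `⟨acc, piece⟩ ↦ if acc = ε then piece else acc`. [folklore] -/
def firstOp : List Bool → List Bool := iteFn (isNilFn ∘ fstF) sndF fstF

/-- `firstOp` on a pair. [folklore] -/
@[simp] theorem firstOp_boolPair (a b : List Bool) : firstOp (boolPair a b) = if a = [] then b else a := by
  unfold firstOp
  rw [iteFn_decide (P := a = []) (by simp [isNilFn])]
  split_ifs <;> simp

/-- `firstOp ∈ FP`. [folklore] -/
theorem firstOp_mem_FP : firstOp ∈ FP := iteFn_mem_FP (comp_mem_FP isNilFn_mem_FP fstF_mem_FP) sndF_mem_FP fstF_mem_FP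

/-- Growth of `firstOp`: additive. [folklore] -/
theorem length_firstOp_le (w : List Bool) : (firstOp w).length ≤ (fstF w).length + (sndF w).length + 0 := by
  unfold firstOp
  rcases oneBit_isNilFn.comp fstF w with ⟨b, hb⟩
  rw [iteFn_apply hb]
  cases b <;> simp

/-- **The hit piece**: on `⟨xx, 1^q⟩`, `1^{q+1}` if the one-bit test `t` holds, else `ε`. [folklore] -/
def hitPiece (t : List Bool → List Bool) : List Bool → List Bool := iteFn t (List.cons true ∘ sndF) fun _ => []

/-- `hitPiece t ∈ FP`. [folklore] -/
theorem hitPiece_mem_FP {t : List Bool → List Bool} (ht : t ∈ FP) : hitPiece t ∈ FP :=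
  iteFn_mem_FP ht (comp_mem_FP (cons_mem_FP true) sndF_mem_FP) (const_mem_FP _)

/-- The model of the first-hit fold: fold `j = i, …, i+k-1` into `a` (`0` = no hit yet,
`j + 1` = first hit at `j`). [folklore] -/
def firstHit (P : ℕ → Prop) [DecidablePred P] : ℕ → ℕ → ℕ → ℕ
  | _, 0, a => a
  | i, k + 1, a => firstHit P (i + 1) k (if a = 0 then (if P i then i + 1 else 0) else a)

/-- Once a hit is recorded it is kept. [folklore] -/
theorem firstHit_of_ne_zero (P : ℕ → Prop) [DecidablePred P] : ∀ (i k a : ℕ), a ≠ 0 → firstHit P i k a = a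
  | _, 0, _, _ => rfl
  | i, k + 1, a, ha => by rw [firstHit, if_neg ha, firstHit_of_ne_zero P (i + 1) k a ha]

/-- **The first-hit fold finds the least index**: from `a = 0`, the result is `j + 1` for the least
`j ∈ [i, i+k)` with `P j`, and `0` if there is none. [folklore] -/
theorem firstHit_spec (P : ℕ → Prop) [DecidablePred P] : ∀ (k i : ℕ),
    (firstHit P i k 0 = 0 ↔ ∀ j, i ≤ j → j < i + k → ¬ P j) ∧
      ∀ j, firstHit P i k 0 = j + 1 → i ≤ j ∧ j < i + k ∧ P j ∧ ∀ j', i ≤ j' → j' < j → ¬ P j'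
  | 0, i => ⟨⟨fun _ j h1 h2 => by omega, fun _ => rfl⟩, fun j h => by simp [firstHit] at h⟩
  | k + 1, i => by
    rw [firstHit, if_pos rfl]
    by_cases hP : P i
    · rw [if_pos hP, firstHit_of_ne_zero P _ _ _ (Nat.succ_ne_zero i)]
      refine ⟨⟨fun h => absurd h (Nat.succ_ne_zero i), fun h => absurd hP (h i le_rfl (by omega))⟩, fun j hj => ?_⟩
      have : j = i := by omega
      subst this
      exact ⟨le_rfl, by omega, hP, fun j' h1 h2 => by omega⟩
    · rw [if_neg hP]
      obtain ⟨h0, h1⟩ := firstHit_spec P k (i + 1)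
      refine ⟨⟨fun h j hj1 hj2 => ?_, fun h => h0.2 fun j hj1 hj2 => h j (by omega) (by omega)⟩, fun j hj => ?_⟩
      · rcases Nat.eq_or_lt_of_le hj1 with rfl | hlt
        · exact hP
        · exact h0.1 h j hlt (by omega)
      · obtain ⟨h2, h3, h4, h5⟩ := h1 j hj
        refine ⟨by omega, by omega, h4, fun j' hj' hlt => ?_⟩
        rcases Nat.eq_or_lt_of_le hj' with rfl | hlt'
        · exact hP
        · exact h5 j' hlt' hlt

/-- The fold of `firstOp` over hit pieces computes `firstHit` (in unary), provided the test is
the decided predicate on the indices visited. [folklore] -/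
theorem foldAcc_firstOp (t : List Bool → List Bool) (xx : List Bool) (P : ℕ → Prop) [DecidablePred P] (B : ℕ)
    (ht : ∀ j, j < B → t (boolPair xx (ones j)) = [decide (P j)]) : ∀ (k i a : ℕ), i + k ≤ B →
    foldAcc firstOp (hitPiece t) xx i k (ones a) = ones (firstHit P i k a)
  | 0, i, a, _ => rfl
  | k + 1, i, a, hB => by
    rw [foldAcc_succ, firstHit, ← foldAcc_firstOp t xx P B ht k (i + 1) _ (by omega)]
    congr 1
    rw [firstOp_boolPair, hitPiece, iteFn_decide (ht i (by omega))]
    simp only [ones_eq_nil_iff, Function.comp_apply, sndF_boolPair, true_cons_ones]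
    by_cases ha : a = 0
    · rw [if_pos ha, if_pos ha]
      by_cases hP : P i
      · rw [if_pos hP, if_pos hP]
      · rw [if_neg hP, if_neg hP]; rfl
    · rw [if_neg ha, if_neg ha]

/-- `1^{3m}` from `xx = ⟨⌜ψ⌝, 1ᵖ⟩`. [folklore] -/
def n3F : List Bool → List Bool := polyFn (3 * X) ∘ fstF ∘ fstF
/-- `1^{p+1}` from `xx`. [folklore] -/
def p1F : List Bool → List Bool := List.cons true ∘ sndF
/-- The record of the first scan: `⟨xx, ⟨bin (3m - (p+1)), ⟨1^{p+1}, ε⟩⟩⟩`. [folklore] -/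
def setup1 : List Bool → List Bool :=
  fanoutFn id (fanoutFn (lenBinF ∘ uSubF ∘ fanoutFn p1F n3F) (fanoutFn p1F fun _ => []))
/-- The record of the second scan: `⟨xx, ⟨bin 3m, ⟨1⁰, ε⟩⟩⟩`. [folklore] -/
def setup2 : List Bool → List Bool :=
  fanoutFn id (fanoutFn (lenBinF ∘ n3F) (fanoutFn (fun _ => []) fun _ => []))
/-- The scan loop: first hit of `[var j = var p]`. [folklore] -/
def scanF : List Bool → List Bool := foldLoop firstOp (clipF 1 (hitPiece varEqPQ)) (3 * X)
/-- First scan: the least `j ∈ (p, 3m)` with the variable of `p`, as `1^{j+1}` (`ε` if none). [folklore] -/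
def run1 : List Bool → List Bool := sndPow 2 ∘ scanF ∘ setup1
/-- Second scan: the least `j ∈ [0, 3m)` with the variable of `p`, as `1^{j+1}`. [folklore] -/
def run2 : List Bool → List Bool := sndPow 2 ∘ scanF ∘ setup2

/-- **`nextPosF ⟨⌜ψ⌝, 1ᵖ⟩ = 1^{nextPos p}`**: the cyclic next occurrence of the variable of `p` (two
first-hit scans, `ThreeCNFPer.nextPos`). [cite: Valiant1979, Lemma 3.1] -/
def nextPosF : List Bool → List Bool :=
  uSubF ∘ fanoutFn (fun _ => [true]) (iteFn (isNilFn ∘ run1) run2 run1)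

/-- `scanF ∈ FP`. [folklore] -/
theorem scanF_mem_FP : scanF ∈ FP :=
  foldLoop_clipF_mem_FP 1 firstOp_mem_FP length_firstOp_le (hitPiece_mem_FP varEqPQ_mem_FP) _

/-- `nextPosF ∈ FP`. [folklore] -/
theorem nextPosF_mem_FP : nextPosF ∈ FP := by
  have hn3 : n3F ∈ FP := comp_mem_FP (polyFn_mem_FP _) (comp_mem_FP fstF_mem_FP fstF_mem_FP)
  have hp1 : p1F ∈ FP := comp_mem_FP (cons_mem_FP true) sndF_mem_FP
  have hs1 : setup1 ∈ FP := fanoutFn_mem_FP id_mem_FP (fanoutFn_mem_FP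
    (comp_mem_FP lenBinF_mem_FP (comp_mem_FP uSubF_mem_FP (fanoutFn_mem_FP hp1 hn3))) (fanoutFn_mem_FP hp1 (const_mem_FP _)))
  have hs2 : setup2 ∈ FP := fanoutFn_mem_FP id_mem_FP (fanoutFn_mem_FP (comp_mem_FP lenBinF_mem_FP hn3)
    (fanoutFn_mem_FP (const_mem_FP _) (const_mem_FP _)))
  have hr1 : run1 ∈ FP := comp_mem_FP (sndPow_mem_FP 2) (comp_mem_FP scanF_mem_FP hs1)
  have hr2 : run2 ∈ FP := comp_mem_FP (sndPow_mem_FP 2) (comp_mem_FP scanF_mem_FP hs2)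
  exact comp_mem_FP uSubF_mem_FP (fanoutFn_mem_FP (const_mem_FP _)
    (iteFn_mem_FP (comp_mem_FP isNilFn_mem_FP hr1) hr2 hr1))

/-- `2m + 2 ≤ |⌜ψ⌝|` (the unary clause count is a field of the code). [folklore] -/
theorem length_le_length_encode : 2 * ψ.length + 2 ≤ (encodingCNF.encode ψ).length := by
  rw [encode_eq, length_boolPair, List.length_replicate]; omega

/-- **Value of the scans.** [folklore] -/
theorem run_encode (hw : CNF.IsWidthEq 3 ψ) {p : ℕ} (hp : p < ψ.length * 3) :
    run1 (boolPair (encodingCNF.encode ψ) (ones p)) =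
        ones (firstHit (fun j => varAt ψ j = varAt ψ p) (p + 1) (ψ.length * 3 - (p + 1)) 0) ∧
      run2 (boolPair (encodingCNF.encode ψ) (ones p)) =
        ones (firstHit (fun j => varAt ψ j = varAt ψ p) 0 (ψ.length * 3) 0) := by
  set xx := boolPair (encodingCNF.encode ψ) (ones p) with hxx
  have hxxlen : ψ.length * 3 ≤ xx.length + 1 := by
    have := length_le_length_encode ψ
    rw [hxx, length_boolPair]; omega
  have hlen : ψ.length * 3 ≤ (3 * X : Polynomial ℕ).eval xx.length := by
    have h3 : (3 * X : Polynomial ℕ).eval xx.length = 3 * xx.length := by simp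
    rw [h3]; omega
  have en3 : n3F xx = ones (ψ.length * 3) := by
    simp [n3F, hxx, encode_eq, Nat.mul_comm]
  have esnd : sndF xx = ones p := by simp [hxx]
  have ht : ∀ j, j < ψ.length * 3 → varEqPQ (boolPair xx (ones j)) = [decide (varAt ψ j = varAt ψ p)] :=
    fun j hj => varEqPQ_encode ψ hw hp hj
  have hclip : ∀ i k, i + k ≤ ψ.length * 3 → ∀ j, i ≤ j → j < i + k →
      (hitPiece varEqPQ (boolPair xx (ones j))).length ≤ 1 * (xx.length + 1) := by
    intro i k hik j hij hjk
    unfold hitPiece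
    rw [iteFn_decide (ht j (by omega))]
    split_ifs
    · simp only [Function.comp_apply, sndF_boolPair, List.length_cons, List.length_replicate]; omega
    · simp
  constructor
  · have hk : ψ.length * 3 - (p + 1) ≤ (3 * X : Polynomial ℕ).eval xx.length := le_trans (Nat.sub_le _ _) hlen
    simp only [run1, Function.comp_apply]
    have hs : setup1 xx = boolPair xx (boolPair (encodeNat (ψ.length * 3 - (p + 1))) (boolPair (ones (p + 1)) [])) := by
      simp only [setup1, fanoutFn_apply, id, Function.comp_apply, p1F, esnd, true_cons_ones, en3,
        uSubF_ones, lenBinF_apply, List.length_replicate]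
    rw [hs, scanF, foldLoop_apply _ _ hk, sndPow_succ_boolPair, sndPow_succ_boolPair, sndPow_zero_boolPair,
      foldAcc_clipF (hclip (p + 1) _ (by omega)), show ([] : List Bool) = ones 0 from rfl,
      foldAcc_firstOp varEqPQ xx _ (ψ.length * 3) ht _ _ _ (by omega)]
  · simp only [run2, Function.comp_apply]
    have hs : setup2 xx = boolPair xx (boolPair (encodeNat (ψ.length * 3)) (boolPair (ones 0) [])) := by
      simp only [setup2, fanoutFn_apply, id, Function.comp_apply, en3, lenBinF_apply, List.length_replicate]
      rfl
    rw [hs, scanF, foldLoop_apply _ _ hlen, sndPow_succ_boolPair, sndPow_succ_boolPair, sndPow_zero_boolPair,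
      foldAcc_clipF (hclip 0 _ (by omega)), show ([] : List Bool) = ones 0 from rfl,
      foldAcc_firstOp varEqPQ xx _ (ψ.length * 3) ht _ _ _ (by omega)]

/-- **Value of `nextPosF`**: the cyclic next occurrence. [cite: Valiant1979, Lemma 3.1] -/
theorem nextPosF_encode (hw : CNF.IsWidthEq 3 ψ) {p : ℕ} (hp : p < ψ.length * 3) :
    nextPosF (boolPair (encodingCNF.encode ψ) (ones p)) = ones (nextPos (ψ.length * 3) (varAt ψ) p) := by
  classical
  obtain ⟨e1, e2⟩ := run_encode ψ hw hp
  set P : ℕ → Prop := fun j => varAt ψ j = varAt ψ p with hP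
  obtain ⟨s1, t1⟩ := firstHit_spec P (ψ.length * 3 - (p + 1)) (p + 1)
  obtain ⟨s2, t2⟩ := firstHit_spec P (ψ.length * 3) 0
  have key : (if firstHit P (p + 1) (ψ.length * 3 - (p + 1)) 0 = 0 then firstHit P 0 (ψ.length * 3) 0
      else firstHit P (p + 1) (ψ.length * 3 - (p + 1)) 0) = nextPos (ψ.length * 3) (varAt ψ) p + 1 := by
    unfold nextPos
    by_cases h0 : firstHit P (p + 1) (ψ.length * 3 - (p + 1)) 0 = 0
    · rw [if_pos h0]
      have hne : ¬ ∃ q, p < q ∧ q < ψ.length * 3 ∧ varAt ψ q = varAt ψ p :=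
        fun ⟨q, hq1, hq2, hq3⟩ => s1.1 h0 q hq1 (by omega) hq3
      have hex : ∃ q, q < ψ.length * 3 ∧ varAt ψ q = varAt ψ p := ⟨p, hp, rfl⟩
      rw [dif_neg hne, dif_pos hex]
      rcases h2 : firstHit P 0 (ψ.length * 3) 0 with _ | j
      · exact absurd (s2.1 h2 p (Nat.zero_le _) (by omega)) (fun h => h rfl)
      · obtain ⟨-, hj2, hj3, hj4⟩ := t2 j h2
        rw [show Nat.find hex = j from (Nat.find_eq_iff hex).2 ⟨⟨by omega, hj3⟩, fun n hn ⟨hn1, hn2⟩ => hj4 n (Nat.zero_le _) hn hn2⟩]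
    · rw [if_neg h0]
      rcases h1 : firstHit P (p + 1) (ψ.length * 3 - (p + 1)) 0 with _ | j
      · exact absurd h1 h0
      · obtain ⟨hj1, hj2, hj3, hj4⟩ := t1 j h1
        have hex : ∃ q, p < q ∧ q < ψ.length * 3 ∧ varAt ψ q = varAt ψ p := ⟨j, by omega, by omega, hj3⟩
        rw [dif_pos hex, show Nat.find hex = j from (Nat.find_eq_iff hex).2
          ⟨⟨by omega, by omega, hj3⟩, fun n hn ⟨hn1, hn2, hn3⟩ => hj4 n (by omega) hn hn3⟩]
  unfold nextPosF
  simp only [Function.comp_apply, fanoutFn_apply]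
  rw [iteFn_decide (P := run1 (boolPair (encodingCNF.encode ψ) (ones p)) = []) (by simp [isNilFn]), e1, e2]
  have hsel : (if ones (firstHit P (p + 1) (ψ.length * 3 - (p + 1)) 0) = [] then ones (firstHit P 0 (ψ.length * 3) 0)
      else ones (firstHit P (p + 1) (ψ.length * 3 - (p + 1)) 0)) = ones (nextPos (ψ.length * 3) (varAt ψ) p + 1) := by
    rw [← key]
    by_cases h : firstHit P (p + 1) (ψ.length * 3 - (p + 1)) 0 = 0
    · simp [h]
    · simp [h]
  rw [hsel, show ([true] : List Bool) = ones 1 from rfl, uSubF_ones, Nat.add_sub_cancel]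

end NextPos

/-! ### Sites and ports -/

section Ports

/-- Pointwise concatenation of two string functions. [folklore] -/
def appendF (f g : List Bool → List Bool) : List Bool → List Bool := fun w => f w ++ g w

/-- `appendF f g w = f w ++ g w`. [folklore] -/
@[simp] theorem appendF_apply (f g : List Bool → List Bool) (w : List Bool) : appendF f g w = f w ++ g w := rfl

/-- `appendF f g ∈ FP`. [folklore] -/
theorem appendF_mem_FP {f g : List Bool → List Bool} (hf : f ∈ FP) (hg : g ∈ FP) : appendF f g ∈ FP :=
  append_mem_FP hf hg

/-- `polyFn (7X) 1ᵃ = 1^{7a}`. [folklore] -/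
theorem polyFn7_ones (a : ℕ) : polyFn (7 * X) (ones a) = ones (7 * a) := by rw [polyFn_apply]; simp
/-- `polyFn (4X) 1ᵃ = 1^{4a}`. [folklore] -/
theorem polyFn4_ones (a : ℕ) : polyFn (4 * X) (ones a) = ones (4 * a) := by rw [polyFn_apply]; simp
/-- `polyFn (3X) 1ᵃ = 1^{3a}`. [folklore] -/
theorem polyFn3_ones (a : ℕ) : polyFn (3 * X) (ones a) = ones (3 * a) := by rw [polyFn_apply]; simp
/-- `polyFn (2X) 1ᵃ = 1^{2a}`. [folklore] -/
theorem polyFn2_ones (a : ℕ) : polyFn (2 * X) (ones a) = ones (2 * a) := by rw [polyFn_apply]; simp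

/-- **`sPosF 1ᵖ = 1^{sPos p}`** (`7 (p/3) + 2 (p mod 3) + 1`). [cite: Valiant1979, Lemma 3.1] -/
def sPosF : List Bool → List Bool :=
  appendF (polyFn (7 * X) ∘ fstF ∘ qrF 3) (appendF (polyFn (2 * X) ∘ sndF ∘ qrF 3) fun _ => [true])

/-- Value of `sPosF`. [folklore] -/
theorem sPosF_ones (p : ℕ) : sPosF (ones p) = ones (sPos p) := by
  simp only [sPosF, appendF_apply, Function.comp_apply, qrF_ones, fstF_boolPair, sndF_boolPair, polyFn7_ones,
    polyFn2_ones, show ([true] : List Bool) = ones 1 from rfl, ones_append, sPos, Nat.add_assoc]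

/-- `sPosF ∈ FP`. [folklore] -/
theorem sPosF_mem_FP : sPosF ∈ FP :=
  appendF_mem_FP (comp_mem_FP (polyFn_mem_FP _) (comp_mem_FP fstF_mem_FP (qrF_mem_FP 3)))
    (appendF_mem_FP (comp_mem_FP (polyFn_mem_FP _) (comp_mem_FP sndF_mem_FP (qrF_mem_FP 3))) (const_mem_FP _))

/-- `1^{3m}` from `⟨x₀, 1ᵏ⟩`. [folklore] -/
def n3K : List Bool → List Bool := polyFn (3 * X) ∘ fstF ∘ fstF
/-- `1^{7m}` from `⟨x₀, 1ᵏ⟩`. [folklore] -/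
def m7K : List Bool → List Bool := polyFn (7 * X) ∘ fstF ∘ fstF
/-- `[k < 3m]`. [folklore] -/
def cK3 : List Bool → List Bool := uLtF ∘ fanoutFn sndF n3K
/-- `1^{k - 3m}`. [folklore] -/
def kSub : List Bool → List Bool := uSubF ∘ fanoutFn n3K sndF

/-- **`site1F ⟨⌜ψ⌝, 1ᵏ⟩ = 1^{site1 k}`**: the first site of variable `k`. [cite: Valiant1979, Lemma 3.1] -/
def site1F : List Bool → List Bool :=
  iteFn cK3 (sPosF ∘ sndF) (appendF m7K (appendF (polyFn (4 * X) ∘ kSub) fun _ => [true, true]))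

/-- **`site2F ⟨⌜ψ⌝, 1ᵏ⟩ = 1^{site2 k}`**: the second site of variable `k`. [cite: Valiant1979, Lemma 3.1] -/
def site2F : List Bool → List Bool :=
  iteFn cK3 (appendF m7K (appendF (polyFn (4 * X) ∘ sndF) fun _ => [true]))
    (appendF m7K (polyFn (4 * X) ∘ nextPosF ∘ fanoutFn fstF kSub))

/-- `n3K ∈ FP`. [folklore] -/
theorem n3K_mem_FP : n3K ∈ FP := comp_mem_FP (polyFn_mem_FP _) (comp_mem_FP fstF_mem_FP fstF_mem_FP)
/-- `m7K ∈ FP`. [folklore] -/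
theorem m7K_mem_FP : m7K ∈ FP := comp_mem_FP (polyFn_mem_FP _) (comp_mem_FP fstF_mem_FP fstF_mem_FP)
/-- `kSub ∈ FP`. [folklore] -/
theorem kSub_mem_FP : kSub ∈ FP := comp_mem_FP uSubF_mem_FP (fanoutFn_mem_FP n3K_mem_FP sndF_mem_FP)
/-- `cK3 ∈ FP`. [folklore] -/
theorem cK3_mem_FP : cK3 ∈ FP := comp_mem_FP uLtF_mem_FP (fanoutFn_mem_FP sndF_mem_FP n3K_mem_FP)

/-- `site1F ∈ FP`. [folklore] -/
theorem site1F_mem_FP : site1F ∈ FP :=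
  iteFn_mem_FP cK3_mem_FP (comp_mem_FP sPosF_mem_FP sndF_mem_FP)
    (appendF_mem_FP m7K_mem_FP (appendF_mem_FP (comp_mem_FP (polyFn_mem_FP _) kSub_mem_FP) (const_mem_FP _)))

/-- `site2F ∈ FP`. [folklore] -/
theorem site2F_mem_FP : site2F ∈ FP :=
  iteFn_mem_FP cK3_mem_FP
    (appendF_mem_FP m7K_mem_FP (appendF_mem_FP (comp_mem_FP (polyFn_mem_FP _) sndF_mem_FP) (const_mem_FP _)))
    (appendF_mem_FP m7K_mem_FP (comp_mem_FP (polyFn_mem_FP _) (comp_mem_FP nextPosF_mem_FP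
      (fanoutFn_mem_FP fstF_mem_FP kSub_mem_FP))))

/-- Value of `site1F`. [cite: Valiant1979, Lemma 3.1] -/
theorem site1F_encode (k : ℕ) : site1F (boolPair (encodingCNF.encode ψ) (ones k)) = ones (PerRed.site1 ψ k) := by
  have e3 : n3K (boolPair (encodingCNF.encode ψ) (ones k)) = ones (ψ.length * 3) := by
    simp only [n3K, Function.comp_apply, fstF_boolPair, encode_eq, polyFn3_ones, Nat.mul_comm]
  have e7 : m7K (boolPair (encodingCNF.encode ψ) (ones k)) = ones (7 * ψ.length) := by
    simp only [m7K, Function.comp_apply, fstF_boolPair, encode_eq, polyFn7_ones]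
  have eK : cK3 (boolPair (encodingCNF.encode ψ) (ones k)) = [decide (k < ψ.length * 3)] := by
    simp only [cK3, Function.comp_apply, fanoutFn_apply, sndF_boolPair, e3, uLtF_ones]
  have ek : kSub (boolPair (encodingCNF.encode ψ) (ones k)) = ones (k - ψ.length * 3) := by
    simp only [kSub, Function.comp_apply, fanoutFn_apply, sndF_boolPair, e3, uSubF_ones]
  unfold site1F PerRed.site1
  rw [iteFn_decide eK]
  by_cases h : k < ψ.length * 3
  · rw [if_pos h, if_pos h, Function.comp_apply, sndF_boolPair, sPosF_ones]
  · rw [if_neg h, if_neg h, appendF_apply, appendF_apply, e7, Function.comp_apply, ek, polyFn4_ones,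
      show ([true, true] : List Bool) = ones 2 from rfl, ones_append, ones_append, Nat.add_assoc]

/-- Value of `site2F` on a 3CNF (`k < 6m`). [cite: Valiant1979, Lemma 3.1] -/
theorem site2F_encode (hw : CNF.IsWidthEq 3 ψ) {k : ℕ} (hk : k < ψ.length * 3 + ψ.length * 3) :
    site2F (boolPair (encodingCNF.encode ψ) (ones k)) = ones (PerRed.site2 ψ k) := by
  have e3 : n3K (boolPair (encodingCNF.encode ψ) (ones k)) = ones (ψ.length * 3) := by
    simp only [n3K, Function.comp_apply, fstF_boolPair, encode_eq, polyFn3_ones, Nat.mul_comm]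
  have e7 : m7K (boolPair (encodingCNF.encode ψ) (ones k)) = ones (7 * ψ.length) := by
    simp only [m7K, Function.comp_apply, fstF_boolPair, encode_eq, polyFn7_ones]
  have eK : cK3 (boolPair (encodingCNF.encode ψ) (ones k)) = [decide (k < ψ.length * 3)] := by
    simp only [cK3, Function.comp_apply, fanoutFn_apply, sndF_boolPair, e3, uLtF_ones]
  have ek : kSub (boolPair (encodingCNF.encode ψ) (ones k)) = ones (k - ψ.length * 3) := by
    simp only [kSub, Function.comp_apply, fanoutFn_apply, sndF_boolPair, e3, uSubF_ones]
  unfold site2F PerRed.site2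
  rw [iteFn_decide eK]
  by_cases h : k < ψ.length * 3
  · rw [if_pos h, if_pos h, appendF_apply, appendF_apply, e7, Function.comp_apply, sndF_boolPair, polyFn4_ones,
      show ([true] : List Bool) = ones 1 from rfl, ones_append, ones_append, Nat.add_assoc]
  · rw [if_neg h, if_neg h, appendF_apply, e7, Function.comp_apply, Function.comp_apply, fanoutFn_apply, fstF_boolPair,
      ek, nextPosF_encode ψ hw (by omega), polyFn4_ones, ones_append]

/-- The sites on `⟨x₀, ⟨1ˣ, ⟨1ᵏ, 1ᵍ⟩⟩⟩`. [folklore] -/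
def s1P : List Bool → List Bool := site1F ∘ fanoutFn (nthF 0) (nthF 2)
/-- The second site. [folklore] -/
def s2P : List Bool → List Bool := site2F ∘ fanoutFn (nthF 0) (nthF 2)
/-- `[g = 0 ∧ x = site1 k]`. [folklore] -/
def cP1 : List Bool → List Bool := andFn (isNilFn ∘ sndPow 2) (uEqF ∘ fanoutFn (nthF 1) s1P)
/-- `[g = 1 ∧ x = site2 k]`. [folklore] -/
def cP2 : List Bool → List Bool := andFn (uEqF ∘ fanoutFn (sndPow 2) fun _ => [true]) (uEqF ∘ fanoutFn (nthF 1) s2P)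

/-- **The port entry `portEntry x k g`** on `⟨⌜ψ⌝, ⟨1ˣ, ⟨1ᵏ, 1ᵍ⟩⟩⟩`, as a `zcode`. [cite: Valiant1979, Lemma 3.1] -/
def portEntryF : List Bool → List Bool := iteFn cP1 (fun _ => [true]) (iteFn cP2 (fun _ => [true]) fun _ => [])

/-- `portEntryF ∈ FP`. [folklore] -/
theorem portEntryF_mem_FP : portEntryF ∈ FP := by
  have h1 : s1P ∈ FP := comp_mem_FP site1F_mem_FP (fanoutFn_mem_FP (nthF_mem_FP 0) (nthF_mem_FP 2))
  have h2 : s2P ∈ FP := comp_mem_FP site2F_mem_FP (fanoutFn_mem_FP (nthF_mem_FP 0) (nthF_mem_FP 2))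
  exact iteFn_mem_FP (andFn_mem_FP (comp_mem_FP isNilFn_mem_FP (sndPow_mem_FP 2))
      (comp_mem_FP uEqF_mem_FP (fanoutFn_mem_FP (nthF_mem_FP 1) h1))) (const_mem_FP _)
    (iteFn_mem_FP (andFn_mem_FP (comp_mem_FP uEqF_mem_FP (fanoutFn_mem_FP (sndPow_mem_FP 2) (const_mem_FP _)))
      (comp_mem_FP uEqF_mem_FP (fanoutFn_mem_FP (nthF_mem_FP 1) h2))) (const_mem_FP _) (const_mem_FP _))

/-- **Value of `portEntryF`** (`k < 6m`). [cite: Valiant1979, Lemma 3.1] -/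
theorem portEntryF_encode (hw : CNF.IsWidthEq 3 ψ) (x : ℕ) {k : ℕ} (hk : k < ψ.length * 3 + ψ.length * 3) (g : ℕ) :
    portEntryF (boolPair (encodingCNF.encode ψ) (boolPair (ones x) (boolPair (ones k) (ones g)))) =
      zcode (PerRed.portEntry ψ x k g) := by
  set z := boolPair (encodingCNF.encode ψ) (boolPair (ones x) (boolPair (ones k) (ones g))) with hz
  have e0 : nthF 0 z = encodingCNF.encode ψ := by simp [hz]
  have e1 : nthF 1 z = ones x := by simp [hz]
  have e2 : nthF 2 z = ones k := by simp [hz]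
  have eg : sndPow 2 z = ones g := by simp [hz]
  have es1 : s1P z = ones (PerRed.site1 ψ k) := by
    simp only [s1P, Function.comp_apply, fanoutFn_apply, e0, e2, site1F_encode]
  have es2 : s2P z = ones (PerRed.site2 ψ k) := by
    simp only [s2P, Function.comp_apply, fanoutFn_apply, e0, e2, site2F_encode ψ hw hk]
  have c1 : cP1 z = [decide (g = 0 ∧ x = PerRed.site1 ψ k)] := by
    unfold cP1
    rw [andFn_apply (b := decide (g = 0)) (b' := decide (x = PerRed.site1 ψ k))
      (by simp only [Function.comp_apply, eg, isNilFn, ones_eq_nil_iff])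
      (by simp only [Function.comp_apply, fanoutFn_apply, e1, es1, uEqF_ones])]
    simp only [Bool.decide_and]
  have c2 : cP2 z = [decide (g = 1 ∧ x = PerRed.site2 ψ k)] := by
    unfold cP2
    rw [andFn_apply (b := decide (g = 1)) (b' := decide (x = PerRed.site2 ψ k))
      (by simp only [Function.comp_apply, fanoutFn_apply, eg, show ([true] : List Bool) = ones 1 from rfl, uEqF_ones])
      (by simp only [Function.comp_apply, fanoutFn_apply, e1, es2, uEqF_ones])]
    simp only [Bool.decide_and]
  unfold portEntryF PerRed.portEntry
  rw [iteFn_decide c1]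
  by_cases h1 : g = 0 ∧ x = PerRed.site1 ψ k
  · rw [if_pos h1, if_pos h1]; rfl
  rw [if_neg h1, if_neg h1, iteFn_decide c2]
  by_cases h2 : g = 1 ∧ x = PerRed.site2 ψ k
  · rw [if_pos h2, if_pos h2]; rfl
  · rw [if_neg h2, if_neg h2]; rfl

end Ports

/-! ### The two-site matrix entries: `gEntryF`, and the slot activities `actUF` -/

section GEntry

/-- `nB = 19m`. [folklore] -/
theorem nB_eq : PerRed.nB ψ = 19 * ψ.length := by unfold PerRed.nB; ring
/-- `nG = 43m`. [folklore] -/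
theorem nG_eq : PerRed.nG ψ = 43 * ψ.length := by unfold PerRed.nG PerRed.nB; ring

/-- `polyFn (19X) 1ᵃ = 1^{19a}`. [folklore] -/
theorem polyFn19_ones (a : ℕ) : polyFn (19 * X) (ones a) = ones (19 * a) := by rw [polyFn_apply]; simp
/-- `polyFn (43X) 1ᵃ = 1^{43a}`. [folklore] -/
theorem polyFn43_ones (a : ℕ) : polyFn (43 * X) (ones a) = ones (43 * a) := by rw [polyFn_apply]; simp
/-- `polyFn (9X+1) 1ᵃ = 1^{9a+1}`. [folklore] -/
theorem polyFn91_ones (a : ℕ) : polyFn (9 * X + 1) (ones a) = ones (9 * a + 1) := by rw [polyFn_apply]; simp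

/-- `1^{nB}` from `⟨x₀, …⟩`. [folklore] -/
def nBF : List Bool → List Bool := polyFn (19 * X) ∘ fstF ∘ nthF 0
/-- `[x < nB]`. [folklore] -/
def cXB : List Bool → List Bool := uLtF ∘ fanoutFn (nthF 1) nBF
/-- `[y < nB]`. [folklore] -/
def cYB : List Bool → List Bool := uLtF ∘ fanoutFn (sndPow 1) nBF
/-- `⟨1^{(x-nB)/4}, 1^{(x-nB) mod 4}⟩`. [folklore] -/
def dXB : List Bool → List Bool := qrF 4 ∘ uSubF ∘ fanoutFn nBF (nthF 1)
/-- `⟨1^{(y-nB)/4}, 1^{(y-nB) mod 4}⟩`. [folklore] -/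
def dYB : List Bool → List Bool := qrF 4 ∘ uSubF ∘ fanoutFn nBF (sndPow 1)

/-- **The two-site matrix entry `gEntry x y`** on `⟨⌜ψ⌝, ⟨1ˣ, 1ʸ⟩⟩`, as a `zcode`
(the if-tree of `PerRed.gEntry`). [cite: Valiant1979, Lemma 3.1] -/
def gEntryF : List Bool → List Bool :=
  iteFn cXB
    (iteFn cYB baseEntryF (portEntryF ∘ fanoutFn (nthF 0) (fanoutFn (nthF 1) dYB)))
    (iteFn cYB (portEntryF ∘ fanoutFn (nthF 0) (fanoutFn (sndPow 1) dXB))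
      (iteFn (uEqF ∘ fanoutFn (fstF ∘ dXB) (fstF ∘ dYB)) (coreCF ∘ fanoutFn (sndF ∘ dXB) (sndF ∘ dYB)) fun _ => []))

/-- `gEntryF ∈ FP`. [folklore] -/
theorem gEntryF_mem_FP : gEntryF ∈ FP := by
  have hB : nBF ∈ FP := comp_mem_FP (polyFn_mem_FP _) (comp_mem_FP fstF_mem_FP (nthF_mem_FP 0))
  have hX : cXB ∈ FP := comp_mem_FP uLtF_mem_FP (fanoutFn_mem_FP (nthF_mem_FP 1) hB)
  have hY : cYB ∈ FP := comp_mem_FP uLtF_mem_FP (fanoutFn_mem_FP (sndPow_mem_FP 1) hB)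
  have hdX : dXB ∈ FP := comp_mem_FP (qrF_mem_FP 4) (comp_mem_FP uSubF_mem_FP (fanoutFn_mem_FP hB (nthF_mem_FP 1)))
  have hdY : dYB ∈ FP := comp_mem_FP (qrF_mem_FP 4) (comp_mem_FP uSubF_mem_FP (fanoutFn_mem_FP hB (sndPow_mem_FP 1)))
  exact iteFn_mem_FP hX
    (iteFn_mem_FP hY baseEntryF_mem_FP (comp_mem_FP portEntryF_mem_FP (fanoutFn_mem_FP (nthF_mem_FP 0)
      (fanoutFn_mem_FP (nthF_mem_FP 1) hdY))))
    (iteFn_mem_FP hY (comp_mem_FP portEntryF_mem_FP (fanoutFn_mem_FP (nthF_mem_FP 0) (fanoutFn_mem_FP (sndPow_mem_FP 1) hdX)))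
      (iteFn_mem_FP (comp_mem_FP uEqF_mem_FP (fanoutFn_mem_FP (comp_mem_FP fstF_mem_FP hdX) (comp_mem_FP fstF_mem_FP hdY)))
        (comp_mem_FP coreCF_mem_FP (fanoutFn_mem_FP (comp_mem_FP sndF_mem_FP hdX) (comp_mem_FP sndF_mem_FP hdY)))
        (const_mem_FP _)))

/-- **Value of `gEntryF`** (`x, y < 43m`). [cite: Valiant1979, Lemma 3.1] -/
theorem gEntryF_encode (hw : CNF.IsWidthEq 3 ψ) {x y : ℕ} (hx : x < PerRed.nG ψ) (hy : y < PerRed.nG ψ) :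
    gEntryF (boolPair (encodingCNF.encode ψ) (boolPair (ones x) (ones y))) = zcode (PerRed.gEntry ψ x y) := by
  rw [nG_eq] at hx hy
  set z := boolPair (encodingCNF.encode ψ) (boolPair (ones x) (ones y)) with hz
  have e0 : nthF 0 z = encodingCNF.encode ψ := by simp [hz]
  have e1 : nthF 1 z = ones x := by simp [hz]
  have e2 : sndPow 1 z = ones y := by simp [hz]
  have eB : nBF z = ones (19 * ψ.length) := by
    simp only [nBF, Function.comp_apply, e0, encode_eq, fstF_boolPair, polyFn19_ones]
  have eX : cXB z = [decide (x < 19 * ψ.length)] := by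
    simp only [cXB, Function.comp_apply, fanoutFn_apply, e1, eB, uLtF_ones]
  have eY : cYB z = [decide (y < 19 * ψ.length)] := by
    simp only [cYB, Function.comp_apply, fanoutFn_apply, e2, eB, uLtF_ones]
  have edX : dXB z = boolPair (ones ((x - 19 * ψ.length) / 4)) (ones ((x - 19 * ψ.length) % 4)) := by
    simp only [dXB, Function.comp_apply, fanoutFn_apply, eB, e1, uSubF_ones, qrF_ones]
  have edY : dYB z = boolPair (ones ((y - 19 * ψ.length) / 4)) (ones ((y - 19 * ψ.length) % 4)) := by
    simp only [dYB, Function.comp_apply, fanoutFn_apply, eB, e2, uSubF_ones, qrF_ones]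
  have eKK : (uEqF ∘ fanoutFn (fstF ∘ dXB) (fstF ∘ dYB)) z =
      [decide ((x - 19 * ψ.length) / 4 = (y - 19 * ψ.length) / 4)] := by
    simp only [Function.comp_apply, fanoutFn_apply, edX, edY, fstF_boolPair, uEqF_ones]
  have hkx : (x - 19 * ψ.length) / 4 < ψ.length * 3 + ψ.length * 3 := by omega
  have hky : (y - 19 * ψ.length) / 4 < ψ.length * 3 + ψ.length * 3 := by omega
  unfold gEntryF PerRed.gEntry
  rw [nB_eq, iteFn_decide eX]
  by_cases h1 : x < 19 * ψ.length
  · rw [if_pos h1, if_pos h1, iteFn_decide eY]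
    by_cases h2 : y < 19 * ψ.length
    · rw [if_pos h2, if_pos h2, hz, baseEntryF_encode ψ hw]
    · rw [if_neg h2, if_neg h2]
      simp only [Function.comp_apply, fanoutFn_apply, e0, e1, edY]
      exact portEntryF_encode ψ hw x hky _
  rw [if_neg h1, if_neg h1, iteFn_decide eY]
  by_cases h2 : y < 19 * ψ.length
  · rw [if_pos h2, if_pos h2]
    simp only [Function.comp_apply, fanoutFn_apply, e0, e2, edX]
    exact portEntryF_encode ψ hw y hkx _
  rw [if_neg h2, if_neg h2, iteFn_decide eKK]
  by_cases h3 : (x - 19 * ψ.length) / 4 = (y - 19 * ψ.length) / 4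
  · rw [if_pos h3, if_pos h3]
    simp only [Function.comp_apply, fanoutFn_apply, edX, edY, sndF_boolPair, coreCF_ones]
  · rw [if_neg h3, if_neg h3]; rfl

/-- **The slot activity `actOf r c`** on `⟨⌜ψ⌝, ⟨1ʳ, 1ᶜ⟩⟩`, in unary: `1` if the entry is `1`,
`q + 1 = 9m + 1` if it is `-1`, `0` otherwise (`liftAct`). [cite: Valiant1979, §4] -/
def actUF : List Bool → List Bool :=
  iteFn (uEqF ∘ fanoutFn gEntryF fun _ => [true]) (fun _ => [true])
    (iteFn (uEqF ∘ fanoutFn gEntryF fun _ => [true, true]) (polyFn (9 * X + 1) ∘ fstF ∘ nthF 0) fun _ => [])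

/-- `actUF ∈ FP`. [folklore] -/
theorem actUF_mem_FP : actUF ∈ FP :=
  iteFn_mem_FP (comp_mem_FP uEqF_mem_FP (fanoutFn_mem_FP gEntryF_mem_FP (const_mem_FP _))) (const_mem_FP _)
    (iteFn_mem_FP (comp_mem_FP uEqF_mem_FP (fanoutFn_mem_FP gEntryF_mem_FP (const_mem_FP _)))
      (comp_mem_FP (polyFn_mem_FP _) (comp_mem_FP fstF_mem_FP (nthF_mem_FP 0))) (const_mem_FP _))

/-- `zcode z` as a unary numeral: `1 ↦ 1`, `-1 ↦ 2`, else `0`. [folklore] -/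
theorem zcode_eq_ones (z : ℤ) : zcode z = ones (if z = 1 then 1 else if z = -1 then 2 else 0) := by
  unfold zcode; split_ifs <;> rfl

/-- **Value of `actUF`** (`r, c < 43m`). [cite: Valiant1979, §4] -/
theorem actUF_encode (hw : CNF.IsWidthEq 3 ψ) {r c : ℕ} (hr : r < PerRed.nG ψ) (hc : c < PerRed.nG ψ) :
    actUF (boolPair (encodingCNF.encode ψ) (boolPair (ones r) (ones c))) = ones (PerRed.actOf ψ r c) := by
  have eg := gEntryF_encode ψ hw hr hc
  rw [zcode_eq_ones] at eg
  have c1 : (uEqF ∘ fanoutFn gEntryF fun _ => [true]) (boolPair (encodingCNF.encode ψ) (boolPair (ones r) (ones c))) =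
      [decide ((if PerRed.gEntry ψ r c = 1 then 1 else if PerRed.gEntry ψ r c = -1 then 2 else 0) = 1)] := by
    simp only [Function.comp_apply, fanoutFn_apply, eg, show ([true] : List Bool) = ones 1 from rfl, uEqF_ones]
  have c2 : (uEqF ∘ fanoutFn gEntryF fun _ => [true, true]) (boolPair (encodingCNF.encode ψ) (boolPair (ones r) (ones c))) =
      [decide ((if PerRed.gEntry ψ r c = 1 then 1 else if PerRed.gEntry ψ r c = -1 then 2 else 0) = 2)] := by
    simp only [Function.comp_apply, fanoutFn_apply, eg, show ([true, true] : List Bool) = ones 2 from rfl, uEqF_ones]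
  unfold actUF PerRed.actOf Literature.LinearAlgebra.Matrix.liftAct PerRed.qMod
  rw [iteFn_decide c1]
  by_cases h1 : PerRed.gEntry ψ r c = 1
  · simp [h1]
  rw [iteFn_decide c2]
  by_cases h2 : PerRed.gEntry ψ r c = -1
  · simp only [h2, if_true]
    simp only [Function.comp_apply, nthF_zero_boolPair, encode_eq, fstF_boolPair, polyFn91_ones, Nat.mul_comm]
    rfl
  · simp [h1, h2]

end GEntry

/-! ### The `0/1` matrix entries: `bEntryF` -/

section BEntry

/-- `q + 1 = 9m + 1`. [folklore] -/
theorem qMod_succ_eq : PerRed.qMod ψ + 1 = 9 * ψ.length + 1 := by unfold PerRed.qMod; ring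

/-- `x₀` from `z = ⟨⟨⟨x₀, pad⟩, 1ᵃ⟩, 1ᵇ⟩` (the shape the word-fold pieces see). [folklore] -/
def bX0 : List Bool → List Bool := fstF ∘ fstF ∘ fstF
/-- `1ᵃ`. [folklore] -/
def bA : List Bool → List Bool := sndF ∘ fstF
/-- `1^{nG} = 1^{43m}`. [folklore] -/
def bNG : List Bool → List Bool := polyFn (43 * X) ∘ fstF ∘ bX0
/-- `1^{q+1} = 1^{9m+1}`. [folklore] -/
def bK1 : List Bool → List Bool := polyFn (9 * X + 1) ∘ fstF ∘ bX0
/-- `[a < nG]`. [folklore] -/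
def cAG : List Bool → List Bool := uLtF ∘ fanoutFn bA bNG
/-- `[b < nG]`. [folklore] -/
def cBG : List Bool → List Bool := uLtF ∘ fanoutFn sndF bNG
/-- `⟨1^{s}, 1^{jj}⟩` of the row index: `s = (a - nG)/(q+1)`, `jj = (a - nG) mod (q+1)`. [folklore] -/
def decA : List Bool → List Bool := divModFn ∘ fanoutFn bK1 (uSubF ∘ fanoutFn bNG bA)
/-- The same for the column index. [folklore] -/
def decB : List Bool → List Bool := divModFn ∘ fanoutFn bK1 (uSubF ∘ fanoutFn bNG sndF)
/-- `⟨1ʳ, 1ᶜ⟩` of the row index's slot: `r = s / nG`, `c = s mod nG`. [folklore] -/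
def rcA : List Bool → List Bool := divModFn ∘ fanoutFn bNG (fstF ∘ decA)
/-- The same for the column index. [folklore] -/
def rcB : List Bool → List Bool := divModFn ∘ fanoutFn bNG (fstF ∘ decB)
/-- The activity of the row index's slot, in unary. [folklore] -/
def actA : List Bool → List Bool := actUF ∘ fanoutFn bX0 rcA
/-- The activity of the column index's slot, in unary. [folklore] -/
def actB : List Bool → List Bool := actUF ∘ fanoutFn bX0 rcB
/-- Old row, gadget column: `[a = r_B ∧ jj_B = 0 ∧ 0 < act_B]`. [cite: Valiant1979, §4] -/
def cond1 : List Bool → List Bool :=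
  andFn (uEqF ∘ fanoutFn bA (fstF ∘ rcB)) (andFn (isNilFn ∘ sndF ∘ decB) (notFn (isNilFn ∘ actB)))
/-- Gadget row, old column: `[b = c_A ∧ jj_A < act_A]`. [cite: Valiant1979, §4] -/
def cond2 : List Bool → List Bool :=
  andFn (uEqF ∘ fanoutFn sndF (sndF ∘ rcA)) (uLtF ∘ fanoutFn (sndF ∘ decA) actA)
/-- Gadget row and column: `[s_A = s_B ∧ (jj_A = jj_B ∨ (jj_A < jj_B ∧ jj_B < act_A))]`. [cite: Valiant1979, §4] -/
def cond3 : List Bool → List Bool :=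
  andFn (uEqF ∘ fanoutFn (fstF ∘ decA) (fstF ∘ decB))
    (iteFn (uEqF ∘ fanoutFn (sndF ∘ decA) (sndF ∘ decB)) (fun _ => [true])
      (andFn (uLtF ∘ fanoutFn (sndF ∘ decA) (sndF ∘ decB)) (uLtF ∘ fanoutFn (sndF ∘ decB) actA)))

/-- **The `0/1` entry `[bEntry a b]`** on `⟨⟨⟨⌜ψ⌝, pad⟩, 1ᵃ⟩, 1ᵇ⟩` (the if-tree of `PerRed.bEntry`). [cite: Valiant1979, Thm. 1] -/
def bEntryF : List Bool → List Bool :=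
  iteFn cAG (iteFn cBG (fun _ => [false]) cond1) (iteFn cBG cond2 cond3)

/-- `bEntryF ∈ FP`. [folklore] -/
theorem bEntryF_mem_FP : bEntryF ∈ FP := by
  have hX0 : bX0 ∈ FP := comp_mem_FP fstF_mem_FP (comp_mem_FP fstF_mem_FP fstF_mem_FP)
  have hA : bA ∈ FP := comp_mem_FP sndF_mem_FP fstF_mem_FP
  have hNG : bNG ∈ FP := comp_mem_FP (polyFn_mem_FP _) (comp_mem_FP fstF_mem_FP hX0)
  have hK1 : bK1 ∈ FP := comp_mem_FP (polyFn_mem_FP _) (comp_mem_FP fstF_mem_FP hX0)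
  have hcA : cAG ∈ FP := comp_mem_FP uLtF_mem_FP (fanoutFn_mem_FP hA hNG)
  have hcB : cBG ∈ FP := comp_mem_FP uLtF_mem_FP (fanoutFn_mem_FP sndF_mem_FP hNG)
  have hdA : decA ∈ FP := comp_mem_FP divModFn_mem_FP (fanoutFn_mem_FP hK1 (comp_mem_FP uSubF_mem_FP (fanoutFn_mem_FP hNG hA)))
  have hdB : decB ∈ FP := comp_mem_FP divModFn_mem_FP (fanoutFn_mem_FP hK1 (comp_mem_FP uSubF_mem_FP (fanoutFn_mem_FP hNG sndF_mem_FP)))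
  have hrA : rcA ∈ FP := comp_mem_FP divModFn_mem_FP (fanoutFn_mem_FP hNG (comp_mem_FP fstF_mem_FP hdA))
  have hrB : rcB ∈ FP := comp_mem_FP divModFn_mem_FP (fanoutFn_mem_FP hNG (comp_mem_FP fstF_mem_FP hdB))
  have haA : actA ∈ FP := comp_mem_FP actUF_mem_FP (fanoutFn_mem_FP hX0 hrA)
  have haB : actB ∈ FP := comp_mem_FP actUF_mem_FP (fanoutFn_mem_FP hX0 hrB)
  have h1 : cond1 ∈ FP := andFn_mem_FP (comp_mem_FP uEqF_mem_FP (fanoutFn_mem_FP hA (comp_mem_FP fstF_mem_FP hrB)))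
    (andFn_mem_FP (comp_mem_FP isNilFn_mem_FP (comp_mem_FP sndF_mem_FP hdB)) (notFn_mem_FP (comp_mem_FP isNilFn_mem_FP haB)))
  have h2 : cond2 ∈ FP := andFn_mem_FP (comp_mem_FP uEqF_mem_FP (fanoutFn_mem_FP sndF_mem_FP (comp_mem_FP sndF_mem_FP hrA)))
    (comp_mem_FP uLtF_mem_FP (fanoutFn_mem_FP (comp_mem_FP sndF_mem_FP hdA) haA))
  have h3 : cond3 ∈ FP := andFn_mem_FP (comp_mem_FP uEqF_mem_FP (fanoutFn_mem_FP (comp_mem_FP fstF_mem_FP hdA) (comp_mem_FP fstF_mem_FP hdB)))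
    (iteFn_mem_FP (comp_mem_FP uEqF_mem_FP (fanoutFn_mem_FP (comp_mem_FP sndF_mem_FP hdA) (comp_mem_FP sndF_mem_FP hdB))) (const_mem_FP _)
      (andFn_mem_FP (comp_mem_FP uLtF_mem_FP (fanoutFn_mem_FP (comp_mem_FP sndF_mem_FP hdA) (comp_mem_FP sndF_mem_FP hdB)))
        (comp_mem_FP uLtF_mem_FP (fanoutFn_mem_FP (comp_mem_FP sndF_mem_FP hdB) haA))))
  exact iteFn_mem_FP hcA (iteFn_mem_FP hcB (const_mem_FP _) h1) (iteFn_mem_FP hcB h2 h3)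

/-- `bEntryF` is one-bit. [folklore] -/
theorem oneBit_bEntryF : OneBit bEntryF := by
  have hc : ∀ c : List Bool → List Bool, OneBit (uEqF ∘ c) := fun c => oneBit_uEqF.comp _
  have hl : ∀ c : List Bool → List Bool, OneBit (uLtF ∘ c) := fun c => oneBit_uLtF.comp _
  refine (hl _).ite ((hl _).ite (oneBit_const _) ?_) ((hl _).ite ?_ ?_)
  · exact oneBit_andFn (hc _) (oneBit_andFn (oneBit_isNilFn.comp _) (oneBit_notFn (oneBit_isNilFn.comp _)))
  · exact oneBit_andFn (hc _) (hl _)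
  · exact oneBit_andFn (hc _) ((hc _).ite (oneBit_const _) (oneBit_andFn (hl _) (hl _)))

/-- The record the word-fold pieces see: `⟨⟨⟨x₀, pad⟩, 1ᵃ⟩, 1ᵇ⟩`. [folklore] -/
def wrec (x pad : List Bool) (a b : ℕ) : List Bool := boolPair (boolPair (boolPair x pad) (ones a)) (ones b)

section WrecValues

variable (pad : List Bool) (a b : ℕ)

/-- Accessor values on the record. [folklore] -/
theorem bX0_wrec (x : List Bool) : bX0 (wrec x pad a b) = x := by simp [bX0, wrec]
/-- Accessor values on the record. [folklore] -/
theorem bA_wrec (x : List Bool) : bA (wrec x pad a b) = ones a := by simp [bA, wrec]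
/-- Accessor values on the record. [folklore] -/
theorem sndF_wrec (x : List Bool) : sndF (wrec x pad a b) = ones b := by simp [wrec]

/-- `bNG = 1^{nG}`. [folklore] -/
theorem bNG_wrec : bNG (wrec (encodingCNF.encode ψ) pad a b) = ones (PerRed.nG ψ) := by
  rw [bNG, Function.comp_apply, Function.comp_apply, bX0_wrec, encode_eq, fstF_boolPair, polyFn43_ones, nG_eq]
/-- `bK1 = 1^{q+1}`. [folklore] -/
theorem bK1_wrec : bK1 (wrec (encodingCNF.encode ψ) pad a b) = ones (PerRed.qMod ψ + 1) := by
  rw [bK1, Function.comp_apply, Function.comp_apply, bX0_wrec, encode_eq, fstF_boolPair, polyFn91_ones, qMod_succ_eq]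
/-- `cAG = [a < nG]`. [folklore] -/
theorem cAG_wrec : cAG (wrec (encodingCNF.encode ψ) pad a b) = [decide (a < PerRed.nG ψ)] := by
  rw [cAG, Function.comp_apply, fanoutFn_apply, bA_wrec, bNG_wrec, uLtF_ones]
/-- `cBG = [b < nG]`. [folklore] -/
theorem cBG_wrec : cBG (wrec (encodingCNF.encode ψ) pad a b) = [decide (b < PerRed.nG ψ)] := by
  rw [cBG, Function.comp_apply, fanoutFn_apply, sndF_wrec, bNG_wrec, uLtF_ones]
/-- `decA = ⟨1^{s_A}, 1^{jj_A}⟩`. [folklore] -/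
theorem decA_wrec : decA (wrec (encodingCNF.encode ψ) pad a b) =
    boolPair (ones ((a - PerRed.nG ψ) / (PerRed.qMod ψ + 1))) (ones ((a - PerRed.nG ψ) % (PerRed.qMod ψ + 1))) := by
  rw [decA, Function.comp_apply, fanoutFn_apply, bK1_wrec, Function.comp_apply, fanoutFn_apply, bNG_wrec, bA_wrec,
    uSubF_ones, divModFn_boolPair]
/-- `decB = ⟨1^{s_B}, 1^{jj_B}⟩`. [folklore] -/
theorem decB_wrec : decB (wrec (encodingCNF.encode ψ) pad a b) =
    boolPair (ones ((b - PerRed.nG ψ) / (PerRed.qMod ψ + 1))) (ones ((b - PerRed.nG ψ) % (PerRed.qMod ψ + 1))) := by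
  rw [decB, Function.comp_apply, fanoutFn_apply, bK1_wrec, Function.comp_apply, fanoutFn_apply, bNG_wrec, sndF_wrec,
    uSubF_ones, divModFn_boolPair]
/-- `rcA = ⟨1^{r_A}, 1^{c_A}⟩`. [folklore] -/
theorem rcA_wrec : rcA (wrec (encodingCNF.encode ψ) pad a b) =
    boolPair (ones ((a - PerRed.nG ψ) / (PerRed.qMod ψ + 1) / PerRed.nG ψ))
      (ones ((a - PerRed.nG ψ) / (PerRed.qMod ψ + 1) % PerRed.nG ψ)) := by
  rw [rcA, Function.comp_apply, fanoutFn_apply, bNG_wrec, Function.comp_apply, decA_wrec, fstF_boolPair, divModFn_boolPair]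
/-- `rcB = ⟨1^{r_B}, 1^{c_B}⟩`. [folklore] -/
theorem rcB_wrec : rcB (wrec (encodingCNF.encode ψ) pad a b) =
    boolPair (ones ((b - PerRed.nG ψ) / (PerRed.qMod ψ + 1) / PerRed.nG ψ))
      (ones ((b - PerRed.nG ψ) / (PerRed.qMod ψ + 1) % PerRed.nG ψ)) := by
  rw [rcB, Function.comp_apply, fanoutFn_apply, bNG_wrec, Function.comp_apply, decB_wrec, fstF_boolPair, divModFn_boolPair]

/-- A gadget index has its slot in range. [folklore] -/
theorem slot_bounds {t : ℕ} (ht : t < PerRed.nTot ψ) (hle : PerRed.nG ψ ≤ t) :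
    (t - PerRed.nG ψ) / (PerRed.qMod ψ + 1) / PerRed.nG ψ < PerRed.nG ψ ∧
      (t - PerRed.nG ψ) / (PerRed.qMod ψ + 1) % PerRed.nG ψ < PerRed.nG ψ := by
  have ht' : t < PerRed.nG ψ + PerRed.nG ψ * PerRed.nG ψ * (PerRed.qMod ψ + 1) := ht
  have hs : (t - PerRed.nG ψ) / (PerRed.qMod ψ + 1) < PerRed.nG ψ * PerRed.nG ψ :=
    Nat.div_lt_of_lt_mul (by rw [Nat.mul_comm]; omega)
  have hGpos : 0 < PerRed.nG ψ := Nat.pos_of_ne_zero fun h0 => by rw [h0] at hs; simp at hs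
  exact ⟨Nat.div_lt_of_lt_mul hs, Nat.mod_lt _ hGpos⟩

/-- `actA = 1^{act_A}` for a gadget row index. [cite: Valiant1979, §4] -/
theorem actA_wrec (hw : CNF.IsWidthEq 3 ψ) (ha : a < PerRed.nTot ψ) (hle : PerRed.nG ψ ≤ a) :
    actA (wrec (encodingCNF.encode ψ) pad a b) = ones (PerRed.actOf ψ
      ((a - PerRed.nG ψ) / (PerRed.qMod ψ + 1) / PerRed.nG ψ) ((a - PerRed.nG ψ) / (PerRed.qMod ψ + 1) % PerRed.nG ψ)) := by
  obtain ⟨hr, hc⟩ := slot_bounds ψ ha hle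
  rw [actA, Function.comp_apply, fanoutFn_apply, bX0_wrec, rcA_wrec]
  exact actUF_encode ψ hw hr hc
/-- `actB = 1^{act_B}` for a gadget column index. [cite: Valiant1979, §4] -/
theorem actB_wrec (hw : CNF.IsWidthEq 3 ψ) (hb : b < PerRed.nTot ψ) (hle : PerRed.nG ψ ≤ b) :
    actB (wrec (encodingCNF.encode ψ) pad a b) = ones (PerRed.actOf ψ
      ((b - PerRed.nG ψ) / (PerRed.qMod ψ + 1) / PerRed.nG ψ) ((b - PerRed.nG ψ) / (PerRed.qMod ψ + 1) % PerRed.nG ψ)) := by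
  obtain ⟨hr, hc⟩ := slot_bounds ψ hb hle
  rw [actB, Function.comp_apply, fanoutFn_apply, bX0_wrec, rcB_wrec]
  exact actUF_encode ψ hw hr hc

/-- Value of `cond1`. [cite: Valiant1979, §4] -/
theorem cond1_wrec (hw : CNF.IsWidthEq 3 ψ) (hb : b < PerRed.nTot ψ) (hle : PerRed.nG ψ ≤ b) :
    cond1 (wrec (encodingCNF.encode ψ) pad a b) = [decide (a = (b - PerRed.nG ψ) / (PerRed.qMod ψ + 1) / PerRed.nG ψ ∧
      (b - PerRed.nG ψ) % (PerRed.qMod ψ + 1) = 0 ∧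
      0 < PerRed.actOf ψ ((b - PerRed.nG ψ) / (PerRed.qMod ψ + 1) / PerRed.nG ψ)
        ((b - PerRed.nG ψ) / (PerRed.qMod ψ + 1) % PerRed.nG ψ))] := by
  unfold cond1
  rw [andFn_apply (b := decide (a = (b - PerRed.nG ψ) / (PerRed.qMod ψ + 1) / PerRed.nG ψ))
    (b' := decide ((b - PerRed.nG ψ) % (PerRed.qMod ψ + 1) = 0) &&
      !decide (PerRed.actOf ψ ((b - PerRed.nG ψ) / (PerRed.qMod ψ + 1) / PerRed.nG ψ)
        ((b - PerRed.nG ψ) / (PerRed.qMod ψ + 1) % PerRed.nG ψ) = 0))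
    (by rw [Function.comp_apply, fanoutFn_apply, bA_wrec, Function.comp_apply, rcB_wrec, fstF_boolPair, uEqF_ones])
    (andFn_apply (by rw [Function.comp_apply, Function.comp_apply, decB_wrec, sndF_boolPair]; simp [isNilFn])
      (notFn_apply (by rw [Function.comp_apply, actB_wrec ψ pad a b hw hb hle]; simp [isNilFn])))]
  congr 1
  simp only [Bool.decide_and, Nat.pos_iff_ne_zero, ne_eq, decide_not]

/-- Value of `cond2`. [cite: Valiant1979, §4] -/
theorem cond2_wrec (hw : CNF.IsWidthEq 3 ψ) (ha : a < PerRed.nTot ψ) (hle : PerRed.nG ψ ≤ a) :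
    cond2 (wrec (encodingCNF.encode ψ) pad a b) = [decide (b = (a - PerRed.nG ψ) / (PerRed.qMod ψ + 1) % PerRed.nG ψ ∧
      (a - PerRed.nG ψ) % (PerRed.qMod ψ + 1) < PerRed.actOf ψ ((a - PerRed.nG ψ) / (PerRed.qMod ψ + 1) / PerRed.nG ψ)
        ((a - PerRed.nG ψ) / (PerRed.qMod ψ + 1) % PerRed.nG ψ))] := by
  unfold cond2
  rw [andFn_apply (b := decide (b = (a - PerRed.nG ψ) / (PerRed.qMod ψ + 1) % PerRed.nG ψ))
    (b' := decide ((a - PerRed.nG ψ) % (PerRed.qMod ψ + 1) < PerRed.actOf ψ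
      ((a - PerRed.nG ψ) / (PerRed.qMod ψ + 1) / PerRed.nG ψ) ((a - PerRed.nG ψ) / (PerRed.qMod ψ + 1) % PerRed.nG ψ)))
    (by rw [Function.comp_apply, fanoutFn_apply, sndF_wrec, Function.comp_apply, rcA_wrec, sndF_boolPair, uEqF_ones])
    (by rw [Function.comp_apply, fanoutFn_apply, Function.comp_apply, decA_wrec, sndF_boolPair,
      actA_wrec ψ pad a b hw ha hle, uLtF_ones])]
  simp only [Bool.decide_and]

/-- Value of `cond3`. [cite: Valiant1979, §4] -/
theorem cond3_wrec (hw : CNF.IsWidthEq 3 ψ) (ha : a < PerRed.nTot ψ) (hle : PerRed.nG ψ ≤ a) :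
    cond3 (wrec (encodingCNF.encode ψ) pad a b) =
      [decide ((a - PerRed.nG ψ) / (PerRed.qMod ψ + 1) = (b - PerRed.nG ψ) / (PerRed.qMod ψ + 1) ∧
        ((a - PerRed.nG ψ) % (PerRed.qMod ψ + 1) = (b - PerRed.nG ψ) % (PerRed.qMod ψ + 1) ∨
          ((a - PerRed.nG ψ) % (PerRed.qMod ψ + 1) < (b - PerRed.nG ψ) % (PerRed.qMod ψ + 1) ∧
            (b - PerRed.nG ψ) % (PerRed.qMod ψ + 1) < PerRed.actOf ψ
              ((a - PerRed.nG ψ) / (PerRed.qMod ψ + 1) / PerRed.nG ψ) ((a - PerRed.nG ψ) / (PerRed.qMod ψ + 1) % PerRed.nG ψ))))] := by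
  have ejA : (sndF ∘ decA) (wrec (encodingCNF.encode ψ) pad a b) = ones ((a - PerRed.nG ψ) % (PerRed.qMod ψ + 1)) := by
    rw [Function.comp_apply, decA_wrec, sndF_boolPair]
  have ejB : (sndF ∘ decB) (wrec (encodingCNF.encode ψ) pad a b) = ones ((b - PerRed.nG ψ) % (PerRed.qMod ψ + 1)) := by
    rw [Function.comp_apply, decB_wrec, sndF_boolPair]
  have eor : (iteFn (uEqF ∘ fanoutFn (sndF ∘ decA) (sndF ∘ decB)) (fun _ => [true])
      (andFn (uLtF ∘ fanoutFn (sndF ∘ decA) (sndF ∘ decB)) (uLtF ∘ fanoutFn (sndF ∘ decB) actA)))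
      (wrec (encodingCNF.encode ψ) pad a b) =
      [decide ((a - PerRed.nG ψ) % (PerRed.qMod ψ + 1) = (b - PerRed.nG ψ) % (PerRed.qMod ψ + 1) ∨
        ((a - PerRed.nG ψ) % (PerRed.qMod ψ + 1) < (b - PerRed.nG ψ) % (PerRed.qMod ψ + 1) ∧
          (b - PerRed.nG ψ) % (PerRed.qMod ψ + 1) < PerRed.actOf ψ
            ((a - PerRed.nG ψ) / (PerRed.qMod ψ + 1) / PerRed.nG ψ) ((a - PerRed.nG ψ) / (PerRed.qMod ψ + 1) % PerRed.nG ψ)))] := by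
    rw [iteFn_decide (P := (a - PerRed.nG ψ) % (PerRed.qMod ψ + 1) = (b - PerRed.nG ψ) % (PerRed.qMod ψ + 1))
      (by rw [Function.comp_apply, fanoutFn_apply, ejA, ejB, uEqF_ones])]
    by_cases h : (a - PerRed.nG ψ) % (PerRed.qMod ψ + 1) = (b - PerRed.nG ψ) % (PerRed.qMod ψ + 1)
    · rw [if_pos h]; simp [h]
    · rw [if_neg h, andFn_apply
        (b := decide ((a - PerRed.nG ψ) % (PerRed.qMod ψ + 1) < (b - PerRed.nG ψ) % (PerRed.qMod ψ + 1)))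
        (b' := decide ((b - PerRed.nG ψ) % (PerRed.qMod ψ + 1) < PerRed.actOf ψ
          ((a - PerRed.nG ψ) / (PerRed.qMod ψ + 1) / PerRed.nG ψ) ((a - PerRed.nG ψ) / (PerRed.qMod ψ + 1) % PerRed.nG ψ)))
        (by rw [Function.comp_apply, fanoutFn_apply, ejA, ejB, uLtF_ones])
        (by rw [Function.comp_apply, fanoutFn_apply, ejB, actA_wrec ψ pad a b hw ha hle, uLtF_ones])]
      simp only [h, false_or, Bool.decide_and]
  unfold cond3
  rw [andFn_apply (b := decide ((a - PerRed.nG ψ) / (PerRed.qMod ψ + 1) = (b - PerRed.nG ψ) / (PerRed.qMod ψ + 1)))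
    (by rw [Function.comp_apply, fanoutFn_apply, Function.comp_apply, decA_wrec, Function.comp_apply, decB_wrec,
      fstF_boolPair, fstF_boolPair, uEqF_ones]) eor]
  simp only [Bool.decide_and]

end WrecValues

/-- **Value of `bEntryF`** (`a, b < n`). [cite: Valiant1979, Thm. 1] -/
theorem bEntryF_encode (hw : CNF.IsWidthEq 3 ψ) (pad : List Bool) {a b : ℕ} (ha : a < PerRed.nTot ψ)
    (hb : b < PerRed.nTot ψ) :
    bEntryF (wrec (encodingCNF.encode ψ) pad a b) = [PerRed.bEntry ψ a b] := by
  unfold bEntryF PerRed.bEntry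
  rw [iteFn_decide (cAG_wrec ψ pad a b)]
  by_cases h1 : a < PerRed.nG ψ
  · rw [if_pos h1, if_pos h1, iteFn_decide (cBG_wrec ψ pad a b)]
    by_cases h2 : b < PerRed.nG ψ
    · rw [if_pos h2, if_pos h2]
    · rw [if_neg h2, if_neg h2, cond1_wrec ψ pad a b hw hb (not_lt.1 h2)]
  rw [if_neg h1, if_neg h1, iteFn_decide (cBG_wrec ψ pad a b)]
  by_cases h2 : b < PerRed.nG ψ
  · rw [if_pos h2, if_pos h2, cond2_wrec ψ pad a b hw ha (not_lt.1 h1)]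
  · rw [if_neg h2, if_neg h2, cond3_wrec ψ pad a b hw ha (not_lt.1 h1)]

end BEntry

/-! ### The word: two nested concatenation folds -/

section Word

/-- The size polynomial `n(m) = 43m + (43m)² (9m + 1)`. [folklore] -/
def nPoly : Polynomial ℕ := 43 * X + (43 * X) ^ 2 * (9 * X + 1)

/-- `n(m) = nTot`. [folklore] -/
theorem nPoly_eval : nPoly.eval ψ.length = PerRed.nTot ψ := by
  simp only [nPoly, eval_add, eval_mul, eval_pow, eval_ofNat, eval_X, eval_one]
  unfold PerRed.nTot PerRed.qMod
  rw [nG_eq]; ring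

/-- `1ⁿ` from a context `c₀ = ⟨⌜ψ⌝, pad⟩`. [folklore] -/
def nUF : List Bool → List Bool := polyFn nPoly ∘ fstF ∘ fstF

/-- Value of `nUF`. [folklore] -/
theorem nUF_ctx (pad : List Bool) : nUF (boolPair (encodingCNF.encode ψ) pad) = ones (PerRed.nTot ψ) := by
  rw [nUF, Function.comp_apply, Function.comp_apply, fstF_boolPair, encode_eq, fstF_boolPair, polyFn_apply,
    List.length_replicate, nPoly_eval]

/-- `nUF ∈ FP`. [folklore] -/
theorem nUF_mem_FP : nUF ∈ FP := comp_mem_FP (polyFn_mem_FP _) (comp_mem_FP fstF_mem_FP fstF_mem_FP)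

/-- **The row word** on `⟨c₀, 1ᵃ⟩`: the bits `[bEntry a b]`, `b < n`, concatenated. [cite: Valiant1979, Thm. 1] -/
def rowF : List Bool → List Bool := sndPow 2 ∘ foldLoop appF (clipF 1 bEntryF) X ∘ setupS (nUF ∘ fstF)

/-- `rowF ∈ FP`. [folklore] -/
theorem rowF_mem_FP : rowF ∈ FP :=
  comp_mem_FP (sndPow_mem_FP 2) (comp_mem_FP (foldLoop_clipF_mem_FP 1 appF_mem_FP length_appF_le bEntryF_mem_FP _)
    (setupS_mem_FP (comp_mem_FP nUF_mem_FP fstF_mem_FP)))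

/-- The context `c₀ = ⟨⌜ψ⌝, 1ⁿ⟩` (the pad makes every row "short in the first field"). [folklore] -/
def ctxOf : List Bool := boolPair (encodingCNF.encode ψ) (ones (PerRed.nTot ψ))

/-- `n ≤ |c₀|`. [folklore] -/
theorem nTot_le_length_ctxOf : PerRed.nTot ψ ≤ (ctxOf ψ).length := by
  rw [ctxOf, length_boolPair, List.length_replicate]; omega

/-- **Value of the row word.** [cite: Valiant1979, Thm. 1] -/
theorem rowF_apply (hw : CNF.IsWidthEq 3 ψ) {a : ℕ} (ha : a < PerRed.nTot ψ) :
    rowF (boolPair (ctxOf ψ) (ones a)) = ccat (fun b => [PerRed.bEntry ψ a b]) (PerRed.nTot ψ) := by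
  set xx := boolPair (ctxOf ψ) (ones a) with hxx
  have hk : (nUF ∘ fstF) xx = ones (PerRed.nTot ψ) := by
    rw [Function.comp_apply, hxx, fstF_boolPair, ctxOf, nUF_ctx]
  have hle : PerRed.nTot ψ ≤ (X : Polynomial ℕ).eval xx.length := by
    rw [eval_X, hxx, length_boolPair]
    have := nTot_le_length_ctxOf ψ
    omega
  rw [rowF, Function.comp_apply, Function.comp_apply, setupS_apply, hk, List.length_replicate,
    foldLoop_apply _ _ hle, sndPow_succ_boolPair, sndPow_succ_boolPair, sndPow_zero_boolPair,
    foldAcc_clipF (fun b _ hb => by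
      rw [Nat.zero_add] at hb
      rw [hxx, ctxOf, show boolPair (boolPair (boolPair (encodingCNF.encode ψ) (ones (PerRed.nTot ψ))) (ones a)) (ones b) =
        wrec (encodingCNF.encode ψ) (ones (PerRed.nTot ψ)) a b from rfl, bEntryF_encode ψ hw _ ha hb]
      simp),
    foldAcc_appF]
  simp only [List.nil_append, Nat.zero_add]
  exact ccat_congr' (fun b hb => by rw [hxx, ctxOf]; exact bEntryF_encode ψ hw _ ha hb) _ le_rfl
where
  /-- `ccat` only reads the pieces below the count -/
  ccat_congr' {f g : ℕ → List Bool} (h : ∀ j, j < PerRed.nTot ψ → f j = g j) :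
      ∀ n, n ≤ PerRed.nTot ψ → ccat f n = ccat g n
    | 0, _ => rfl
    | n + 1, hn => by rw [ccat_succ, ccat_succ, ccat_congr' h n (by omega), h n (by omega)]

end Word

section WordAll

/-- **The matrix word** on the context `c₀`: the row words, `a < n`, concatenated. [cite: Valiant1979, Thm. 1] -/
def wordF : List Bool → List Bool := sndPow 2 ∘ foldLoop appF (clipF 1 rowF) X ∘ setupS nUF

/-- `wordF ∈ FP`. [folklore] -/
theorem wordF_mem_FP : wordF ∈ FP :=
  comp_mem_FP (sndPow_mem_FP 2) (comp_mem_FP (foldLoop_clipF_mem_FP 1 appF_mem_FP length_appF_le rowF_mem_FP _)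
    (setupS_mem_FP nUF_mem_FP))

/-- `ccat` only reads the pieces below the count. [folklore] -/
theorem ccat_congr {f g : ℕ → List Bool} {N : ℕ} (h : ∀ j, j < N → f j = g j) : ∀ n, n ≤ N → ccat f n = ccat g n
  | 0, _ => rfl
  | n + 1, hn => by rw [ccat_succ, ccat_succ, ccat_congr h n (by omega), h n (by omega)]

/-- A row of bits has length `n`. [folklore] -/
theorem length_ccat_bits (g : ℕ → Bool) (n : ℕ) : (ccat (fun j => [g j]) n).length = n := by
  rw [ccat_singleton, List.length_ofFn]

/-- **Value of the matrix word.** [cite: Valiant1979, Thm. 1] -/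
theorem wordF_apply (hw : CNF.IsWidthEq 3 ψ) :
    wordF (ctxOf ψ) = ccat (fun a => ccat (fun b => [PerRed.bEntry ψ a b]) (PerRed.nTot ψ)) (PerRed.nTot ψ) := by
  have hk : nUF (ctxOf ψ) = ones (PerRed.nTot ψ) := nUF_ctx ψ _
  have hle : PerRed.nTot ψ ≤ (X : Polynomial ℕ).eval (ctxOf ψ).length := by
    rw [eval_X]; exact nTot_le_length_ctxOf ψ
  rw [wordF, Function.comp_apply, Function.comp_apply, setupS_apply, hk, List.length_replicate,
    foldLoop_apply _ _ hle, sndPow_succ_boolPair, sndPow_succ_boolPair, sndPow_zero_boolPair,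
    foldAcc_clipF (fun a _ ha => by
      rw [Nat.zero_add] at ha
      rw [rowF_apply ψ hw ha, length_ccat_bits]
      have := nTot_le_length_ctxOf ψ
      omega),
    foldAcc_appF]
  simp only [List.nil_append, Nat.zero_add]
  exact ccat_congr (fun a ha => rowF_apply ψ hw ha) _ le_rfl

/-- **The double concatenation is the row-major word `bWord`** of `PermanentReductionCodes.lean`. [folklore] -/
theorem ccat_ccat_eq_bWord :
    ccat (fun a => ccat (fun b => [PerRed.bEntry ψ a b]) (PerRed.nTot ψ)) (PerRed.nTot ψ) = PerRed.bWord ψ := by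
  apply List.ext_getElem
  · rw [length_ccat_const _ (fun a => length_ccat_bits _ _), PerRed.length_bWord]
  · intro t h1 h2
    rw [PerRed.length_bWord] at h2
    have hn : 0 < PerRed.nTot ψ := Nat.pos_of_ne_zero fun h0 => by rw [h0] at h2; simp at h2
    have hi : t / PerRed.nTot ψ < PerRed.nTot ψ := Nat.div_lt_of_lt_mul h2
    have hj : t % PerRed.nTot ψ < PerRed.nTot ψ := Nat.mod_lt _ hn
    have key := getD_ccat_const (fun a => ccat (fun b => [PerRed.bEntry ψ a b]) (PerRed.nTot ψ))
      (fun a => length_ccat_bits _ _) false (PerRed.nTot ψ) hi hj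
    rw [Nat.div_add_mod' t (PerRed.nTot ψ), List.getD_eq_getElem _ _ h1, ccat_singleton,
      List.getD_eq_getElem _ _ (by rw [List.length_ofFn]; exact hj), List.getElem_ofFn] at key
    rw [key]
    unfold PerRed.bWord
    rw [List.getElem_ofFn]

/-- **The padded context** `x₀ ↦ ⟨x₀, 1ⁿ⟩`. [folklore] -/
def mkCtx : List Bool → List Bool := fanoutFn id (polyFn nPoly ∘ fstF)

/-- `mkCtx ⌜ψ⌝ = c₀`. [folklore] -/
theorem mkCtx_encode : mkCtx (encodingCNF.encode ψ) = ctxOf ψ := by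
  rw [mkCtx, fanoutFn_apply, id, Function.comp_apply, encode_eq, fstF_boolPair, polyFn_apply, List.length_replicate,
    nPoly_eval, ← encode_eq, ctxOf]

/-- `mkCtx ∈ FP`. [folklore] -/
theorem mkCtx_mem_FP : mkCtx ∈ FP := fanoutFn_mem_FP id_mem_FP (comp_mem_FP (polyFn_mem_FP _) fstF_mem_FP)

/-- **The width test** `[every clause has three literals]` on `⌜ψ⌝` (`SharpSATVerif.width3Fn`). [cite: LiskiewiczOgiharaToda2003, §2.3] -/
def w3T : List Bool → List Bool := SharpSATVerif.width3Fn ∘ fanoutFn id fun _ => []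

/-- `w3T ∈ FP`. [folklore] -/
theorem w3T_mem_FP : w3T ∈ FP := comp_mem_FP SharpSATVerif.width3Fn_mem_FP (fanoutFn_mem_FP id_mem_FP (const_mem_FP _))

/-- Value of `w3T`. [folklore] -/
theorem w3T_encode : w3T (encodingCNF.encode ψ) = [decide (CNF.IsWidthEq 3 ψ)] := by
  have h1 := SharpSATVerif.width3Fn_eq_true_iff ψ []
  rcases (oneBit_allFn (SharpSATVerif.oneBit_hdrEqFn [true, true, true])).comp fstF
    (boolPair (encodingCNF.encode ψ) []) with ⟨bb, hbb⟩
  have hv : w3T (encodingCNF.encode ψ) = [bb] := by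
    rw [w3T, Function.comp_apply, fanoutFn_apply, id]; exact hbb
  rw [hv]
  have hv' : SharpSATVerif.width3Fn (boolPair (encodingCNF.encode ψ) []) = [bb] := hbb
  rw [hv'] at h1
  unfold CNF.IsWidthEq
  cases bb
  · have : ¬ ∀ c ∈ ψ, c.length = 3 := fun h => by simpa using h1.2 h
    simp [this]
  · have : ∀ c ∈ ψ, c.length = 3 := h1.1 rfl
    simp only [List.cons.injEq, and_true]
    exact (decide_eq_true this).symm

/-- **The reduction map `preF`**: canonicalise the input; if it codes a 3CNF, the word of its
`0/1` matrix (through the padded context), otherwise the non-square word `00`. [cite: Valiant1979, Thm. 1] -/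
def preF : List Bool → List Bool :=
  iteFn (w3T ∘ KSATRed.canonCNFFn) (wordF ∘ mkCtx ∘ KSATRed.canonCNFFn) fun _ => [false, false]

/-- **`preF ∈ FP`.** [cite: Valiant1979, Thm. 1] -/
theorem preF_mem_FP : preF ∈ FP :=
  iteFn_mem_FP (comp_mem_FP w3T_mem_FP KSATRed.canonCNFFn_mem_FP)
    (comp_mem_FP wordF_mem_FP (comp_mem_FP mkCtx_mem_FP KSATRed.canonCNFFn_mem_FP)) (const_mem_FP _)

/-- **Value of `preF` on every string.** [cite: Valiant1979, Thm. 1] -/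
theorem preF_apply (w : List Bool) :
    preF w = if CNF.IsWidthEq 3 (NegCNF.decCNF w) then PerRed.bWord (NegCNF.decCNF w) else [false, false] := by
  unfold preF
  rw [iteFn_decide (P := CNF.IsWidthEq 3 (NegCNF.decCNF w))
    (by rw [Function.comp_apply, KSATRed.canonCNFFn_eq, w3T_encode])]
  split_ifs with h
  · rw [Function.comp_apply, Function.comp_apply, KSATRed.canonCNFFn_eq, mkCtx_encode, wordF_apply _ h, ccat_ccat_eq_bWord]
  · rfl

end WordAll

end PerRedFP

end Literature.Computability.QuantumComplexity
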